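import Literature.Probability.RandomPlanarGeometry.SLESlopeOccupation
import Literature.Probability.RandomPlanarGeometry.SLEDerivRatioTail
import Literature.Probability.RandomPlanarGeometry.SLEOnePointEstimate
import HarnessLib

/-!
# The sharp one-point upper estimate for the SLE_κ ratio `ψ`, `κ < 8` (Beffara (2008), Prop. 4, upper half)

Topic `Probability/RandomPlanarGeometry`. For `0 < κ < 8`, `z = x + iy ∈ ℍ` and Rohde–Schramm's
ratio `ψₜ(z) = y |gₜ'(z)| / Im gₜ(z)` (whose supremum `Z(z)` controls `dist(z, γ)` by Koebe,
eq. (6.2)), this file proves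

  `P[ ψ reaches λ before τ(z), |w| staying below S up to ρₙ ] ≤ C_κ λ^{-(1-κ/8)} Ĝ(x/y)`  (`λ ≥ λ₀(κ)`)

uniformly in `n, S` (`measureReal_psiHit_le`), with `Ĝ(w) = Ĝ_{1-κ/8,κ}(w + i) = (1+w²)^{-(8-κ)/(2κ)}
`= (sin arg z)^{8/κ-1}`: the **upper** half of V. Beffara, *The dimension of the SLE curves*,
Ann. Probab. 36 (2008), **Prop. 4** ("`P(B(z₀, ε) ∩ H ≠ ∅) ≍ (ε/Im z₀)^{1-κ/8} (sin arg z₀)^{8/κ-1}`"),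
with the angular factor, complementing the lower half `rsGhatSlope_le_rpow_mul_measureReal`
(`SLEDerivRatioTail.lean`) / `measure_infDist_sleTrace_le_ge` (`SLEOnePointLowerEstimate.lean`); then,
without localisation, `P[∃ t < τ(z), ψₜ ≥ λ] ≤ C_κ λ^{-(1-κ/8)} Ĝ(x/y)` (`measureReal_sleRatioReach_le`)
and, by Koebe / eq. (6.2), for the SLE_κ trace `γ` (`HasSLETrace κ`):
`P[dist(z, γ[0,∞)) ≤ ε] ≤ C (ε/y)^{1-κ/8} Ĝ(x/y)` for `0 < ε ≤ c₀ y` (`measure_infDist_sleTrace_le_sharp`),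
the sharp form (exponent exactly `1 - κ/8`, angular factor `Ĝ(x/y) = (y/|z|)^{8/κ-1}`) of the tree's
`measure_infDist_sleTrace_le` (every exponent `a < 1 - κ/8`, no angular factor), and — with the angular
factor, which is what Beffara's Cor. 5 / the main estimate (3.5) of the two-point bound need — of the
tree's `measure_infDist_sleTrace_le_critical` (`SLEOnePointSharpUpper.lean`: exponent `1 - κ/8` by a
renewal argument, no angular factor; the two proofs are independent). A net argument upgrades the
range to `0 < ε ≤ (1-η) y` (`measure_infDist_sleTrace_le_sharp'`).

## Proof

Beffara's printed proof (eqs. (2.6)–(2.8)) gives the lower bound by the martingale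
`Xₛ = sin(θₛ/2)^{8/κ-1} e^{(1-κ/8)s}` and defers the matching upper bound to a spectral-gap
statement for the killed diffusion `θₛ` ("Lemma 2", stated without hypotheses). We supply an
elementary optional-stopping proof in Rohde–Schramm's variables (`ψ`, `w = cot arg zₜ`):

* **Conditional boundary lemma** (`measureReal_inter_grow_le`): for a stopping time `T ≤ σ⋆` and
  `G ∈ 𝓕_T`, `P(G ∩ {ψ grows by the factor e^R after T}) ≤ C ∫_G Ĝ(w_T)`. Split `G` by the dyadic
  size `2^k ≤ |w_T| < 2^{k+1}`; growing `log ψ = ∫ f(w) du` (`f = 4/(1+w²)²`) by `R` while `|w|` stays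
  above `2` forces, along the successive first passages `τ_i` of `|w|` below `2^{k+1-i}` after `T`
  (`hittingFrom`, stopping times), some band occupation `∫_{τ_i}^{σ⋆} g_{2^{k-i}}(w)/y² ≥ c_{k-i}`
  (`exists_occupation_ge`, the deterministic tiling of `[T, t]`); each such event costs
  `2 e^{-μ c} Ĝ(w_T)/Ĝ(2^{k+1-i}) ≤ 2·4^{-(k-i)} Ĝ(w_T)` (`measureReal_inter_occupation_le`: exponential
  supermartingale `(1 + μU)(w) e^{μ ∫ g(w)/y²}`; `measureReal_inter_hit_le`: `Ĝ(w)` is a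
  supermartingale), and returning below `2` costs `Ĝ(w_T)/Ĝ(2)`; the thresholds
  `c_m = C_κ log 2 ((2b+2)m + 3b)/4^m`, `b = (8-κ)/(2κ)`, sum to `≤ R = C_κ log 2 (5b+2)`.
* **Induction over the levels `e^{Rj}`** (`measureReal_psiHit_le_of_nat`): with `H_λ` the hitting time
  of `ψ ≥ λ` (`slePsiHitTime`), `{H_{e^{Rj}} ≤ σ⋆} ⊆ {H_{e^{R(j-1)}} ≤ σ⋆} ∩ {growth by e^R after it}`,
  so by the lemma and the martingale identity `E[ψ_T^{1-κ/8} Ĝ(w_T)] = Ĝ(x/y)` for the critical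
  Rohde–Schramm observable (`integral_stoppedProcess_critical`),
  `P(H_{e^{Rj}} ≤ σ⋆) ≤ C e^{-(1-κ/8)R(j-1)} Ĝ(x/y)`.

## References

* V. Beffara, *The dimension of the SLE curves*, Ann. Probab. 36 (2008) 1421–1452, Prop. 4 and
  its proof (eqs. (2.6)–(2.8)).
* S. Rohde, O. Schramm, *Basic properties of SLE*, Ann. of Math. 161 (2005), Lemma 6.3, (6.2).
* G. F. Lawler, *Conformally Invariant Processes in the Plane*, AMS (2005), Thm. 7.9 (upper half).
-/

noncomputable section

open Set Filter MeasureTheory Metric Complex intervalIntegral Finset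
open _root_.Topology
open scoped NNReal ENNReal BigOperators Real

namespace Literature.Probability.RandomPlanarGeometry

open Loewner Literature.Probability.Process Literature.Analysis.FunctionSpaces

/-! ### Constants -/

section Constants

variable (κ : ℝ≥0)

/-- The critical exponent `b = (8-κ)/(2κ)` of `Ĝ(w) = (1+w²)^{-b}`. [cite: RohdeSchramm2005, Lemma 6.3 (proof, p. 905)] -/
def ghatExp : ℝ := (8 - κ) / (2 * κ)

/-- **The thresholds `c_m = C_κ log 2 ((2b+2)m + 3b)/4^m`** of the band occupations. [folklore] -/
def occThreshold (m : ℕ) : ℝ :=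
  occConst κ * Real.log 2 * ((2 * ghatExp κ + 2) * m + 3 * ghatExp κ) / 4 ^ m

/-- **The growth exponent `R = C_κ log 2 (5b+2)`** (`≥ Σ_m c_m`). [folklore] -/
def growConst : ℝ := occConst κ * Real.log 2 * (5 * ghatExp κ + 2)

/-- **The constant of the conditional boundary lemma**: `1/Ĝ(4) + 1/Ĝ(2) + 1`. [folklore] -/
def growBound : ℝ := (ghatC κ 4)⁻¹ + (ghatC κ 2)⁻¹ + 1

variable {κ}

/-- `b ≥ 0` for `κ ≤ 8`, `κ > 0`. [folklore] -/
theorem ghatExp_nonneg (hκ : 0 < κ) (hκ8 : κ ≤ 8) : 0 ≤ ghatExp κ := by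
  have h8 : (κ : ℝ) ≤ 8 := by exact_mod_cast hκ8
  have h0 : (0 : ℝ) < κ := by exact_mod_cast hκ
  unfold ghatExp
  exact div_nonneg (by linarith) (by positivity)

/-- `Ĝ(w) = (1+w²)^{-b}`. [folklore] -/
theorem ghatC_eq_rpow (hκ : 0 < κ) (w : ℝ) : ghatC κ w = (1 + w ^ 2) ^ (-ghatExp κ) := by
  rw [show ghatC κ w = rsGhatSlope (1 - (κ : ℝ) / 8) κ w from rfl,
    rsGhatSlope_critical (by exact_mod_cast hκ)]
  rfl

/-- **`Ĝ(2^{m+1})⁻¹ ≤ 2^{b(2m+3)}`** (`(1 + 4^{m+1})^b ≤ (2·4^{m+1})^b`). [folklore] -/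
theorem inv_ghatC_pow_le (hκ : 0 < κ) (hκ8 : κ ≤ 8) (m : ℕ) :
    (ghatC κ (2 ^ (m + 1)))⁻¹ ≤ (2 : ℝ) ^ (ghatExp κ * (2 * m + 3)) := by
  have hb := ghatExp_nonneg hκ hκ8
  rw [ghatC_eq_rpow hκ, Real.rpow_neg (by positivity), inv_inv]
  have h1 : (1 : ℝ) + (2 ^ (m + 1)) ^ 2 ≤ 2 ^ (2 * (m : ℝ) + 3) := by
    have h2 : ((2 : ℝ) ^ (m + 1)) ^ 2 = 2 ^ (2 * (m : ℝ) + 2) := by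
      rw [← Real.rpow_natCast, ← Real.rpow_natCast, ← Real.rpow_mul (by norm_num)]
      congr 1; push_cast; ring
    have h3 : (2 : ℝ) ^ (2 * (m : ℝ) + 3) = 2 * 2 ^ (2 * (m : ℝ) + 2) := by
      rw [show 2 * (m : ℝ) + 3 = (2 * (m : ℝ) + 2) + 1 by ring, Real.rpow_add (by norm_num),
        Real.rpow_one, mul_comm]
    rw [h2, h3]
    have : (1 : ℝ) ≤ 2 ^ (2 * (m : ℝ) + 2) := Real.one_le_rpow (by norm_num) (by positivity)
    linarith
  calc ((1 : ℝ) + (2 ^ (m + 1)) ^ 2) ^ ghatExp κ ≤ ((2 : ℝ) ^ (2 * (m : ℝ) + 3)) ^ ghatExp κ :=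
        Real.rpow_le_rpow (by positivity) h1 hb
    _ = (2 : ℝ) ^ (ghatExp κ * (2 * m + 3)) := by
        rw [← Real.rpow_mul (by norm_num)]; congr 1; ring

/-- **`exp(-μ_{2^m} c_m) = 2^{-((2b+2)m+3b)}`** (`μ_{2^m} = 4^m/C_κ`). [folklore] -/
theorem exp_neg_occRateConst_mul_occThreshold (hκ : 0 < κ) (hκ8 : κ < 8) (m : ℕ) :
    Real.exp (-(occRateConst κ (2 ^ m) * occThreshold κ m)) =
      (2 : ℝ) ^ (-((2 * ghatExp κ + 2) * m + 3 * ghatExp κ)) := by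
  have hC := (occConst_pos hκ hκ8).ne'
  have h4 : ((2 : ℝ) ^ m) ^ 2 = 4 ^ m := by
    rw [← pow_mul, mul_comm, pow_mul]; norm_num
  have hprod : occRateConst κ (2 ^ m) * occThreshold κ m =
      Real.log 2 * ((2 * ghatExp κ + 2) * m + 3 * ghatExp κ) := by
    unfold occRateConst occThreshold
    rw [h4]
    field_simp
  rw [hprod, Real.rpow_def_of_pos (by norm_num : (0 : ℝ) < 2)]
  congr 1; ring

/-- **The cost of one band: `2 e^{-μ_{2^m} c_m} / Ĝ(2^{m+1}) ≤ 2 · 4^{-m}`.** [folklore] -/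
theorem band_cost_le (hκ : 0 < κ) (hκ8 : κ < 8) (m : ℕ) :
    2 * Real.exp (-(occRateConst κ (2 ^ m) * occThreshold κ m)) * (ghatC κ (2 ^ (m + 1)))⁻¹ ≤
      2 * ((4 : ℝ) ^ m)⁻¹ := by
  rw [exp_neg_occRateConst_mul_occThreshold hκ hκ8, mul_assoc]
  refine mul_le_mul_of_nonneg_left ?_ (by norm_num)
  calc (2 : ℝ) ^ (-((2 * ghatExp κ + 2) * m + 3 * ghatExp κ)) * (ghatC κ (2 ^ (m + 1)))⁻¹
      ≤ (2 : ℝ) ^ (-((2 * ghatExp κ + 2) * m + 3 * ghatExp κ)) * (2 : ℝ) ^ (ghatExp κ * (2 * m + 3)) :=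
        mul_le_mul_of_nonneg_left (inv_ghatC_pow_le hκ hκ8.le m) (Real.rpow_nonneg (by norm_num) _)
    _ = ((4 : ℝ) ^ m)⁻¹ := by
        rw [← Real.rpow_add (by norm_num)]
        have : -((2 * ghatExp κ + 2) * (m : ℝ) + 3 * ghatExp κ) + ghatExp κ * (2 * m + 3) = -(2 * (m : ℝ)) := by
          ring
        rw [this, Real.rpow_neg (by norm_num), show (4 : ℝ) ^ m = (2 : ℝ) ^ (2 * (m : ℝ)) by
          rw [Real.rpow_mul (by norm_num), Real.rpow_natCast]; norm_num]

/-- `c_m ≥ 0`. [folklore] -/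
theorem occThreshold_nonneg (hκ : 0 < κ) (hκ8 : κ < 8) (m : ℕ) : 0 ≤ occThreshold κ m := by
  have hb := ghatExp_nonneg hκ hκ8.le
  have hC := (occConst_pos hκ hκ8).le
  have hl : 0 ≤ Real.log 2 := Real.log_nonneg (by norm_num)
  unfold occThreshold
  positivity

/-- `c_m ≤ C_κ log 2 (5b+2) 2^{-m}` for `m ≥ 1` (`m/4^m ≤ 2^{-m}`). [folklore] -/
theorem occThreshold_le (hκ : 0 < κ) (hκ8 : κ < 8) {m : ℕ} (hm : 1 ≤ m) :
    occThreshold κ m ≤ growConst κ * ((2 : ℝ) ^ m)⁻¹ := by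
  have hb := ghatExp_nonneg hκ hκ8.le
  have hC := (occConst_pos hκ hκ8).le
  have hl : 0 ≤ Real.log 2 := Real.log_nonneg (by norm_num)
  have hm' : (1 : ℝ) ≤ m := by exact_mod_cast hm
  have hm2 : (m : ℝ) ≤ 2 ^ m := by exact_mod_cast (Nat.lt_two_pow_self).le
  unfold occThreshold growConst
  rw [div_le_iff₀ (by positivity)]
  have h4 : (4 : ℝ) ^ m = 2 ^ m * 2 ^ m := by rw [← mul_pow]; norm_num
  rw [h4, mul_assoc (occConst κ * Real.log 2 * (5 * ghatExp κ + 2)), inv_mul_cancel_left₀ (by positivity)]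
  have h1 : (2 * ghatExp κ + 2) * m + 3 * ghatExp κ ≤ (5 * ghatExp κ + 2) * m := by nlinarith
  calc occConst κ * Real.log 2 * ((2 * ghatExp κ + 2) * m + 3 * ghatExp κ)
      ≤ occConst κ * Real.log 2 * ((5 * ghatExp κ + 2) * m) :=
        mul_le_mul_of_nonneg_left h1 (by positivity)
    _ ≤ occConst κ * Real.log 2 * ((5 * ghatExp κ + 2) * 2 ^ m) :=
        mul_le_mul_of_nonneg_left (mul_le_mul_of_nonneg_left hm2 (by positivity)) (by positivity)
    _ = occConst κ * Real.log 2 * (5 * ghatExp κ + 2) * 2 ^ m := by ring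

/-- `Σ_{m=1}^{k} 2^{-m} ≤ 1`. [folklore] -/
theorem sum_Icc_inv_two_pow_le (k : ℕ) : ∑ m ∈ Finset.Icc 1 k, ((2 : ℝ) ^ m)⁻¹ ≤ 1 := by
  induction k with
  | zero => simp
  | succ k ih =>
    have key : ∀ j : ℕ, ∑ m ∈ Finset.Icc 1 j, ((2 : ℝ) ^ m)⁻¹ = 1 - ((2 : ℝ) ^ j)⁻¹ := by
      intro j
      induction j with
      | zero => simp
      | succ j ihj =>
        rw [Finset.sum_Icc_succ_top (by omega), ihj, pow_succ, mul_inv]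
        ring
    rw [key]
    have : 0 < ((2 : ℝ) ^ (k + 1))⁻¹ := by positivity
    linarith

/-- `Σ_{m=1}^{k} 4^{-m} ≤ 1/3`. [folklore] -/
theorem sum_Icc_inv_four_pow_le (k : ℕ) : ∑ m ∈ Finset.Icc 1 k, ((4 : ℝ) ^ m)⁻¹ ≤ 1 / 3 := by
  have key : ∀ j : ℕ, ∑ m ∈ Finset.Icc 1 j, ((4 : ℝ) ^ m)⁻¹ = (1 - ((4 : ℝ) ^ j)⁻¹) / 3 := by
    intro j
    induction j with
    | zero => simp
    | succ j ihj =>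
      rw [Finset.sum_Icc_succ_top (by omega), ihj, pow_succ, mul_inv]
      ring
  rw [key]
  have : 0 < ((4 : ℝ) ^ k)⁻¹ := by positivity
  linarith

/-- **`Σ_{m=1}^{k} c_m ≤ R`**. [folklore] -/
theorem sum_occThreshold_le (hκ : 0 < κ) (hκ8 : κ < 8) (k : ℕ) :
    ∑ m ∈ Finset.Icc 1 k, occThreshold κ m ≤ growConst κ := by
  have hR : 0 ≤ growConst κ := by
    have hb := ghatExp_nonneg hκ hκ8.le
    have hC := (occConst_pos hκ hκ8).le
    have hl : 0 ≤ Real.log 2 := Real.log_nonneg (by norm_num)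
    unfold growConst; positivity
  calc ∑ m ∈ Finset.Icc 1 k, occThreshold κ m ≤ ∑ m ∈ Finset.Icc 1 k, growConst κ * ((2 : ℝ) ^ m)⁻¹ :=
        Finset.sum_le_sum fun m hm ↦ occThreshold_le hκ hκ8 (Finset.mem_Icc.1 hm).1
    _ = growConst κ * ∑ m ∈ Finset.Icc 1 k, ((2 : ℝ) ^ m)⁻¹ := by rw [Finset.mul_sum]
    _ ≤ growConst κ * 1 := mul_le_mul_of_nonneg_left (sum_Icc_inv_two_pow_le k) hR
    _ = growConst κ := mul_one _

/-- `R > 0`. [folklore] -/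
theorem growConst_pos (hκ : 0 < κ) (hκ8 : κ < 8) : 0 < growConst κ := by
  have hb := ghatExp_nonneg hκ hκ8.le
  have hC := occConst_pos hκ hκ8
  have hl : 0 < Real.log 2 := Real.log_pos (by norm_num)
  unfold growConst; positivity

/-- `growBound ≥ 1`. [folklore] -/
theorem one_le_growBound (hκ : 0 < κ) (hκ8 : κ ≤ 8) : 1 ≤ growBound κ := by
  have h4 := (ghatC_mem_Ioc hκ hκ8 4).1
  have h2 := (ghatC_mem_Ioc hκ hκ8 2).1
  unfold growBound
  have := inv_pos.2 h4; have := inv_pos.2 h2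
  linarith

end Constants

/-! ### Two more facts on `hittingFrom` -/

section HittingMore

variable {Ω E : Type*} {u : ℝ≥0 → Ω → E} {s s' : Set E} {T : Ω → WithTop ℝ≥0} {ω : Ω}

/-- If the path is already in `s` at time `T < ⊤`, the hitting time after `T` is `T`. [folklore] -/
theorem hittingFrom_eq_self_of_mem (hT : T ω ≠ ⊤) (hmem : u (T ω).untopA ω ∈ s) :
    hittingFrom u s T ω = T ω := by
  refine le_antisymm ?_ le_hittingFrom
  have h := hittingFrom_le_of_mem (u := u) (s := s) (T := T) (ω := ω) (j := (T ω).untopA)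
    (by rw [coe_untopA_of_ne_top hT]) hmem
  rwa [coe_untopA_of_ne_top hT] at h

/-- Hitting a larger set happens earlier: `s ⊆ s' → hittingFrom u s' T ≤ hittingFrom u s T`.
[folklore] -/
theorem hittingFrom_anti (h : s ⊆ s') : hittingFrom u s' T ω ≤ hittingFrom u s T ω := by
  by_cases hex : ∃ j : ℝ≥0, T ω ≤ j ∧ u j ω ∈ s
  · have hex' : ∃ j : ℝ≥0, T ω ≤ j ∧ u j ω ∈ s' := hex.imp fun j hj ↦ ⟨hj.1, h hj.2⟩
    rw [hittingFrom_apply_of_exists hex, hittingFrom_apply_of_exists hex', WithTop.coe_le_coe]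
    exact csInf_le_csInf (OrderBot.bddBelow _) hex fun j hj ↦ ⟨hj.1, h hj.2⟩
  · rw [hittingFrom_apply_of_forall (u := u) (s := s) fun j hj hs ↦ hex ⟨j, hj, hs⟩]
    exact le_top

end HittingMore

/-! ### The log-rate of `ψ` and the hitting times of the stopped slope -/

section LogRate

variable (κ : ℝ≥0) (z : ℂ) (S : ℝ) (n : ℕ)

/-- The ratio `ψ` stopped at `σ⋆`. [folklore] -/
abbrev sleStarPsi : ℝ≥0 → (ℝ≥0 → ℝ) → ℝ := stoppedProcess (slePointPsi κ z) (sleStarTime κ z S n)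

/-- **The log-rate `Λ_r = f(w_r) y_r⁻²` of `ψ`** along the flow stopped at `σ⋆`. [folklore] -/
def sleLogRate (r : ℝ≥0) (ω : ℝ≥0 → ℝ) : ℝ :=
  slopeRate (sleStarSlope κ z S n r ω) * (sleStarIm κ z S n r ω)⁻¹ ^ 2

variable {κ z S n}

/-- `Λ ≥ 0`. [folklore] -/
theorem sleLogRate_nonneg (r : ℝ≥0) (ω : ℝ≥0 → ℝ) : 0 ≤ sleLogRate κ z S n r ω :=
  mul_nonneg (slopeRate_nonneg _) (sq_nonneg _)

/-- `Λ` has continuous paths. [folklore] -/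
theorem continuous_sleLogRate (hz : 0 < z.im) (ω : ℝ≥0 → ℝ) : Continuous fun r ↦ sleLogRate κ z S n r ω :=
  (continuous_slopeRate.comp (continuous_sleStopSlope hz sleStarTime_le_locTime ω)).mul
    (((continuous_stoppedProcess_slePointIm hz _ ω).inv₀ fun r ↦ (sleStarIm_pos hz r ω).ne').pow 2)

/-- The band rate is the log-rate where `|w| ≥ ℓ`: `g_ℓ(w_r) y_r⁻² = Λ_r` if `ℓ ≤ |w_r|` (`ℓ > 0`).
[folklore] -/
theorem sleOccRate_eq_sleLogRate {ℓ : ℝ} (hℓ : 0 < ℓ) {r : ℝ≥0} {ω : ℝ≥0 → ℝ}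
    (h : ℓ ≤ |sleStarSlope κ z S n r ω|) : sleOccRate κ z S n ℓ r ω = sleLogRate κ z S n r ω := by
  rw [sleOccRate, sleLogRate, bandRate_eq_slopeRate hℓ h]

/-- **`log ψ_{t₂} - log ψ_{t₁} = ∫_{t₁}^{t₂} Λ`** for `t₁ ≤ t₂ ≤ σ⋆` (eq. (6.3) at the stopped clock).
[cite: RohdeSchramm2005, eq. (6.3)] -/
theorem log_sleStarPsi_sub_eq (hz : 0 < z.im) {t₁ t₂ : ℝ≥0} (h12 : t₁ ≤ t₂) {ω : ℝ≥0 → ℝ}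
    (h2 : (t₂ : WithTop ℝ≥0) ≤ sleStarTime κ z S n ω) :
    Real.log (sleStarPsi κ z S n t₂ ω) - Real.log (sleStarPsi κ z S n t₁ ω) =
      ∫ r in (t₁ : ℝ)..t₂, sleLogRate κ z S n r.toNNReal ω := by
  have hσρ : ∀ ω, sleStarTime κ z S n ω ≤ slePointLocTime κ z n ω := sleStarTime_le_locTime
  set L : ℝ≥0 → (ℝ≥0 → ℝ) → ℝ := trunc (sleStarTime κ z S n) fun s ω ↦ loewnerLogDerivRate
    (stoppedProcess (slePointRe κ z) (sleStarTime κ z S n) s ω) (sleStarIm κ z S n s ω) with hL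
  have hexp : ∀ t : ℝ≥0, sleStarPsi κ z S n t ω = Real.exp (∫ r in (0 : ℝ)..t, L r.toNNReal ω) :=
    fun t ↦ stoppedProcess_slePointPsi_eq_exp hz hσρ t ω
  rw [hexp, hexp, Real.log_exp, Real.log_exp]
  have hLeq : ∀ r : ℝ, r ∈ uIcc (t₁ : ℝ) t₂ → L r.toNNReal ω = sleLogRate κ z S n r.toNNReal ω := by
    intro r hr
    rw [Set.uIcc_of_le (by exact_mod_cast h12)] at hr
    have hrσ : ((r.toNNReal : ℝ≥0) : WithTop ℝ≥0) ≤ sleStarTime κ z S n ω := by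
      refine le_trans ?_ h2
      exact WithTop.coe_le_coe.2 (Real.toNNReal_le_iff_le_coe.2 hr.2)
    simp only [hL, trunc_of_le hrσ]
    rw [sleLogRate, loewnerLogDerivRate_eq_slopeRate (sleStarIm_pos hz _ ω).ne']
    rw [mul_comm]
    rfl
  have hint : ∀ a b : ℝ≥0, IntervalIntegrable (fun r : ℝ ↦ L r.toNNReal ω) volume a b := by
    intro a b
    have hLp : IsStronglyProgressive brownianFiltration L :=
      isStronglyProgressive_trunc (isStronglyProgressive_loewnerLogDerivRate_stopped hz
        (isStoppingTime_sleStarTime hz)) fun t ↦ (isStoppingTime_sleStarTime (κ := κ) (z := z) (S := S)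
          (n := n) hz).measurableSet_lt t
    have hLbd : ∀ t ω, |L t ω| ≤ 4 / (z.im / (n + 2)) ^ 2 := fun t ω ↦ by
      simp only [hL, trunc_apply]
      split_ifs
      · rw [abs_of_nonneg (loewnerLogDerivRate_nonneg _ _)]
        exact loewnerLogDerivRate_stopped_le hz hσρ t ω
      · rw [abs_zero]; positivity
    have h1 : ∀ t : ℝ≥0, IntegrableOn (fun s : ℝ ↦ L s.toNNReal ω) (Set.Icc 0 t) := fun t ↦
      integrableOn_Icc_of_abs_le hLp hLbd ω t
    have hsub : uIcc (a : ℝ) b ⊆ Set.Icc 0 (max a b : ℝ≥0) := by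
      intro s hs
      rcases le_total (a : ℝ) b with hab | hab
      · rw [Set.uIcc_of_le hab] at hs
        exact ⟨a.coe_nonneg.trans hs.1, hs.2.trans (by exact_mod_cast le_max_right a b)⟩
      · rw [Set.uIcc_of_ge hab] at hs
        exact ⟨b.coe_nonneg.trans hs.1, hs.2.trans (by exact_mod_cast le_max_left a b)⟩
    exact (MeasureTheory.IntegrableOn.mono_set (h1 (max a b)) hsub).intervalIntegrable
  rw [← integral_congr hLeq]
  have hadd := integral_add_adjacent_intervals (hint 0 t₁) (hint t₁ t₂)
  rw [NNReal.coe_zero] at hadd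
  linarith

end LogRate

/-! ### The deterministic tiling: growth of `log ψ` forces a band occupation -/

section Tiling

variable {κ : ℝ≥0} {z : ℂ} {S : ℝ} {n : ℕ}

/-- **Growth of `log ψ` by `R` along `[T, t]` forces some band occupation.** Fix a path `ω`, times
`T ≤ t ≤ σ⋆` with `∫_T^t Λ ≥ R`, an increasing sequence of times `τ₀ = T ≤ τ₁ ≤ ⋯ ≤ τ_J = ⊤` such that
on `[T, τ_{i+1})` the stopped slope satisfies `|w| ≥ ℓ_{i+1} > 0` (`i < J`), and thresholds `c_i ≥ 0`
with `Σ_{i<J} c_i ≤ R`. Then for some `i < J`, `τ_i ≤ t` and the occupation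
`∫_{τ_i}^{σ⋆} g_{ℓ_{i+1}}(w_r) y_r⁻² dr ≥ c_i`. (Tile `[T, t]` by the `τ_i ∧ t`; on the `i`-th tile
`Λ = g_{ℓ_{i+1}}(w) y⁻²` since `|w| ≥ ℓ_{i+1}` there.) [folklore] -/
theorem exists_occupation_ge (hz : 0 < z.im) {T : (ℝ≥0 → ℝ) → WithTop ℝ≥0} {ω : ℝ≥0 → ℝ}
    {t : ℝ≥0} (hTt : T ω ≤ t) (htσ : (t : WithTop ℝ≥0) ≤ sleStarTime κ z S n ω)
    {R : ℝ} (hR : R ≤ ∫ r in (((T ω).untopA : ℝ≥0) : ℝ)..(t : ℝ), sleLogRate κ z S n r.toNNReal ω)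
    {J : ℕ} {τ : ℕ → WithTop ℝ≥0} (hτ0 : τ 0 = T ω) (hτmono : ∀ i, τ i ≤ τ (i + 1)) (hτJ : τ J = ⊤)
    {ℓ : ℕ → ℝ} (hℓ : ∀ i, 0 < ℓ i)
    (havoid : ∀ i < J, ∀ r : ℝ≥0, T ω ≤ r → (r : WithTop ℝ≥0) < τ (i + 1) →
      ℓ (i + 1) ≤ |sleStarSlope κ z S n r ω|)
    {c : ℕ → ℝ} (hc0 : ∀ i, 0 ≤ c i) (hc : ∑ i ∈ Finset.range J, c i ≤ R) :
    ∃ i < J, τ i ≠ ⊤ ∧ τ i ≤ t ∧ c i ≤ ∫ r in (((τ i).untopA : ℝ≥0) : ℝ)..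
      (((sleStarTime κ z S n ω).untopA : ℝ≥0) : ℝ), sleOccRate κ z S n (ℓ (i + 1)) r.toNNReal ω := by
  set σs := sleStarTime κ z S n ω with hσs
  set w := sleStarSlope κ z S n with hw
  have hσ' : σs ≠ ⊤ := sleStarTime_ne_top ω
  have hT' : T ω ≠ ⊤ := ne_top_of_le_ne_top WithTop.coe_ne_top hTt
  set T' : ℝ := (((T ω).untopA : ℝ≥0) : ℝ) with hT'def
  set b : ℝ := ((σs.untopA : ℝ≥0) : ℝ) with hbdef
  have hT'0 : 0 ≤ T' := ((T ω).untopA : ℝ≥0).coe_nonneg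
  have hT't : T' ≤ t := by
    have := untopA_le_untopA_of_le hTt WithTop.coe_ne_top
    rwa [untopA_coe] at this
  have htb : (t : ℝ) ≤ b := by
    have := untopA_le_untopA_of_le htσ hσ'
    rwa [untopA_coe] at this
  -- `J ≠ 0`
  have hJ : 0 < J := by
    rcases Nat.eq_zero_or_pos J with h | h
    · subst h; rw [hτ0] at hτJ; exact absurd hτJ hT'
    · exact h
  -- `T ≤ τ i`
  have hTτ : ∀ i, T ω ≤ τ i := by
    intro i
    induction i with
    | zero => rw [hτ0]
    | succ i ih => exact ih.trans (hτmono i)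
  have hτmono' : Monotone τ := monotone_nat_of_le_succ hτmono
  -- the tiling points
  set sf : ℕ → ℝ := fun i ↦ (((min (τ i) (t : WithTop ℝ≥0)).untopA : ℝ≥0) : ℝ) with hsf
  have hmin_ne : ∀ i, min (τ i) (t : WithTop ℝ≥0) ≠ ⊤ := fun i ↦
    ne_top_of_le_ne_top WithTop.coe_ne_top (min_le_right _ _)
  have hsf_le_t : ∀ i, sf i ≤ t := fun i ↦ by
    have := untopA_le_untopA_of_le (min_le_right (τ i) (t : WithTop ℝ≥0)) WithTop.coe_ne_top
    rwa [untopA_coe] at this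
  have hT'_le_sf : ∀ i, T' ≤ sf i := fun i ↦
    untopA_le_untopA_of_le (le_min (hTτ i) hTt) (hmin_ne i)
  have hsf_mono : ∀ i, sf i ≤ sf (i + 1) := fun i ↦
    untopA_le_untopA_of_le (min_le_min_right _ (hτmono i)) (hmin_ne _)
  have hsf0 : sf 0 = T' := by simp only [hsf, hτ0, min_eq_left hTt, hT'def]
  have hsfJ : sf J = t := by simp only [hsf, hτJ, min_eq_right le_top, untopA_coe]
  have hsf_of_le : ∀ i, τ i ≤ t → sf i = (((τ i).untopA : ℝ≥0) : ℝ) := fun i h ↦ by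
    simp only [hsf, min_eq_left h]
  have hsf_of_not_le : ∀ i, ¬ τ i ≤ t → sf i = t := fun i h ↦ by
    simp only [hsf, min_eq_right (le_of_lt (not_le.1 h)), untopA_coe]
  -- integrability
  have hΛc : Continuous fun r : ℝ ↦ sleLogRate κ z S n r.toNNReal ω :=
    (continuous_sleLogRate hz ω).comp continuous_real_toNNReal
  have hΛi : ∀ a b : ℝ, IntervalIntegrable (fun r : ℝ ↦ sleLogRate κ z S n r.toNNReal ω) volume a b :=
    fun a b ↦ hΛc.intervalIntegrable a b
  have hφc : ∀ i, Continuous fun r : ℝ ↦ sleOccRate κ z S n (ℓ (i + 1)) r.toNNReal ω := fun i ↦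
    continuous_sleOccRate_toNNReal hz ω
  -- by contradiction
  by_contra hcon
  push Not at hcon
  -- each tile is at most its threshold, the first one strictly
  have htile : ∀ i < J, (∫ r in (sf i)..(sf (i + 1)), sleLogRate κ z S n r.toNNReal ω) ≤ c i ∧
      (τ i ≤ t → (∫ r in (sf i)..(sf (i + 1)), sleLogRate κ z S n r.toNNReal ω) < c i) := by
    intro i hi
    by_cases hit : τ i ≤ t
    · have hne : τ i ≠ ⊤ := ne_top_of_le_ne_top WithTop.coe_ne_top hit
      have hsfi := hsf_of_le i hit
      -- on the tile, `Λ = g_{ℓ_{i+1}}(w) y⁻²`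
      have heq : (∫ r in (sf i)..(sf (i + 1)), sleLogRate κ z S n r.toNNReal ω) =
          ∫ r in (sf i)..(sf (i + 1)), sleOccRate κ z S n (ℓ (i + 1)) r.toNNReal ω := by
        rw [integral_of_le (hsf_mono i), integral_of_le (hsf_mono i), integral_Ioc_eq_integral_Ioo,
          integral_Ioc_eq_integral_Ioo]
        refine setIntegral_congr_fun measurableSet_Ioo fun r hr ↦ ?_
        have hr0 : 0 ≤ r := hT'0.trans ((hT'_le_sf i).trans hr.1.le)
        have hrr : ((r.toNNReal : ℝ≥0) : ℝ) = r := Real.coe_toNNReal _ hr0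
        have hTr : T ω ≤ (r.toNNReal : ℝ≥0) := by
          rw [← coe_untopA_of_ne_top hT', WithTop.coe_le_coe, ← NNReal.coe_le_coe, hrr]
          exact (hT'_le_sf i).trans hr.1.le
        have hrτ : ((r.toNNReal : ℝ≥0) : WithTop ℝ≥0) < τ (i + 1) := by
          have h1 : ((r.toNNReal : ℝ≥0) : WithTop ℝ≥0) < min (τ (i + 1)) (t : WithTop ℝ≥0) := by
            rw [← coe_untopA_of_ne_top (hmin_ne (i + 1)), WithTop.coe_lt_coe, ← NNReal.coe_lt_coe, hrr]
            exact hr.2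
          exact h1.trans_le (min_le_left _ _)
        exact (sleOccRate_eq_sleLogRate (hℓ (i + 1)) (havoid i hi _ hTr hrτ)).symm
      have hle : (∫ r in (sf i)..(sf (i + 1)), sleOccRate κ z S n (ℓ (i + 1)) r.toNNReal ω) ≤
          ∫ r in (sf i)..b, sleOccRate κ z S n (ℓ (i + 1)) r.toNNReal ω :=
        integral_mono_interval le_rfl (hsf_mono i) ((hsf_le_t _).trans htb)
          (ae_of_all _ fun r ↦ sleOccRate_nonneg _ _ _) ((hφc i).intervalIntegrable _ _)
      have hlt := hcon i hi hne hit
      rw [← hsfi] at hlt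
      rw [heq]
      exact ⟨(hle.trans hlt.le), fun _ ↦ hle.trans_lt hlt⟩
    · have h1 : sf i = t := hsf_of_not_le i hit
      have h2 : sf (i + 1) = t := hsf_of_not_le (i + 1) fun h ↦ hit ((hτmono i).trans h)
      rw [h1, h2, integral_same]
      exact ⟨hc0 i, fun h ↦ absurd h hit⟩
  -- sum the tiles
  have hsum := sum_integral_adjacent_intervals (μ := volume) (f := fun r : ℝ ↦ sleLogRate κ z S n r.toNNReal ω)
    (a := sf) (n := J) fun k _ ↦ hΛi _ _
  rw [hsf0, hsfJ] at hsum
  have hlt : ∑ i ∈ Finset.range J, (∫ r in (sf i)..(sf (i + 1)), sleLogRate κ z S n r.toNNReal ω) <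
      ∑ i ∈ Finset.range J, c i :=
    Finset.sum_lt_sum (fun i hi ↦ (htile i (Finset.mem_range.1 hi)).1)
      ⟨0, Finset.mem_range.2 hJ, (htile 0 hJ).2 (by rw [hτ0]; exact hTt)⟩
  rw [hsum] at hlt
  linarith

end Tiling

/-! ### The growth event and the conditional boundary lemma on a dyadic class -/

section Grow

variable (κ : ℝ≥0) (z : ℂ) (S : ℝ) (n : ℕ)

/-- **The growth event after `T`**: `ψ` grows by the factor `e^R` (`R = growConst κ`) at some time
of `[T, σ⋆]`. [folklore] -/
def sleGrowEvent (T : (ℝ≥0 → ℝ) → WithTop ℝ≥0) : Set (ℝ≥0 → ℝ) :=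
  {ω | ∃ t : ℝ≥0, T ω ≤ t ∧ (t : WithTop ℝ≥0) ≤ sleStarTime κ z S n ω ∧
    Real.exp (growConst κ) * sleStarPsi κ z S n (T ω).untopA ω ≤ sleStarPsi κ z S n t ω}

variable {κ z S n}

/-- A finite hitting time (after `T ≤ σ⋆`) of a closed set by the `σ⋆`-stopped slope is at most `σ⋆`
(the path is constant after `σ⋆`). [folklore] -/
theorem hittingFrom_le_sleStarTime_of_ne_top (hz : 0 < z.im) {T : (ℝ≥0 → ℝ) → WithTop ℝ≥0}
    {ω : ℝ≥0 → ℝ} (hTσ : T ω ≤ sleStarTime κ z S n ω) {s : Set ℝ} (hs : IsClosed s)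
    (hne : hittingFrom (sleStarSlope κ z S n) s T ω ≠ ⊤) :
    hittingFrom (sleStarSlope κ z S n) s T ω ≤ sleStarTime κ z S n ω := by
  obtain ⟨τ₀, hτ₀⟩ := WithTop.ne_top_iff_exists.1 hne
  have hσ' : sleStarTime κ z S n ω ≠ ⊤ := sleStarTime_ne_top ω
  have hmem : sleStarSlope κ z S n τ₀ ω ∈ s :=
    mem_of_hittingFrom_eq_coe hs (continuous_sleStopSlope hz sleStarTime_le_locTime ω) hτ₀.symm
  by_contra hlt
  rw [not_le, ← hτ₀] at hlt
  -- the slope at `σ⋆` equals the slope at `τ₀ > σ⋆`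
  have heq : sleStarSlope κ z S n (sleStarTime κ z S n ω).untopA ω = sleStarSlope κ z S n τ₀ ω := by
    have h1 : sleStarSlope κ z S n (min (τ₀ : WithTop ℝ≥0) (sleStarTime κ z S n ω)).untopA ω =
        sleStarSlope κ z S n (τ₀ : WithTop ℝ≥0).untopA ω := sleStarSlope_min_eq WithTop.coe_ne_top ω
    rw [min_eq_right hlt.le] at h1
    exact h1
  have h2 := hittingFrom_le_of_mem (u := sleStarSlope κ z S n) (s := s) (T := T) (ω := ω)
    (j := (sleStarTime κ z S n ω).untopA) (by rw [coe_untopA_of_ne_top hσ']; exact hTσ) (by rw [heq]; exact hmem)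
  rw [coe_untopA_of_ne_top hσ', ← hτ₀] at h2
  exact absurd (h2.trans_lt hlt) (lt_irrefl _)

/-- `Σ_{i<k} f(k-i) = Σ_{m=1}^{k} f(m)`. [folklore] -/
theorem sum_range_sub_eq_sum_Icc (f : ℕ → ℝ) (k : ℕ) :
    ∑ i ∈ Finset.range k, f (k - i) = ∑ m ∈ Finset.Icc 1 k, f m := by
  refine Finset.sum_nbij' (fun i ↦ k - i) (fun m ↦ k - m) (fun i hi ↦ ?_) (fun m hm ↦ ?_)
    (fun i hi ↦ ?_) (fun m hm ↦ ?_) (fun i _ ↦ rfl)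
  · rw [Finset.mem_range] at hi; rw [Finset.mem_Icc]; omega
  · rw [Finset.mem_Icc] at hm; rw [Finset.mem_range]; omega
  · rw [Finset.mem_range] at hi; omega
  · rw [Finset.mem_Icc] at hm; omega

/-- **The conditional boundary lemma on `{|w_T| < 2^{k+1}}`.** For
`0 < κ < 8`, `z ∈ ℍ`, `|w₀| < S`, a stopping time `T ≤ σ⋆` and `G ∈ 𝓕_T` on which `|w_T| < 2^{k+1}`,
`P(G ∩ {growth by e^R after T}) ≤ (Ĝ(2)⁻¹ + 1) ∫_G Ĝ(w_T) dP`.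
With the levels `ℓ_i = 2^{k+1-i}` and the successive passage times `τ_i = hittingFrom w [-ℓ_i, ℓ_i] T`
(`τ₀ = T` on the class): either `|w|` returns below `2 = ℓ_k` (cost `Ĝ(w_T)/Ĝ(2)`,
`measureReal_inter_hit_le`), or (`exists_occupation_ge`) some band occupation after `τ_i` exceeds
`c_{k-i}`, at cost `2 e^{-μ c_{k-i}} Ĝ(w_T)/Ĝ(ℓ_i) ≤ 2·4^{-(k-i)} Ĝ(w_T)`
(`measureReal_inter_occupation_le`, `measureReal_inter_hit_le`, `band_cost_le`); the geometric sum is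
`≤ 2/3`. [folklore] -/
theorem measureReal_class_grow_le (hκ : 0 < κ) (hκ8 : κ < 8) (hz : 0 < z.im) (h0 : |z.re / z.im| < S)
    {T : (ℝ≥0 → ℝ) → WithTop ℝ≥0} (hT : IsStoppingTime brownianFiltration T)
    (hTσ : ∀ ω, T ω ≤ sleStarTime κ z S n ω) {G : Set (ℝ≥0 → ℝ)}
    (hG : MeasurableSet[hT.measurableSpace] G) {k : ℕ}
    (hGk : G ⊆ {ω | |sleStarSlope κ z S n (T ω).untopA ω| < (2 : ℝ) ^ (k + 1)}) :
    preWienerMeasure.real (G ∩ sleGrowEvent κ z S n T) ≤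
      ((ghatC κ 2)⁻¹ + 1) * ∫ ω in G, ghatC κ (sleStarSlope κ z S n (T ω).untopA ω) ∂preWienerMeasure := by
  haveI := isProbabilityMeasure_preWienerMeasure'
  set P := preWienerMeasure with hP
  set σs := sleStarTime κ z S n with hσs
  set w := sleStarSlope κ z S n with hw
  set ψ := sleStarPsi κ z S n with hψ
  set R := growConst κ with hR
  set I : ℝ := ∫ ω in G, ghatC κ (w (T ω).untopA ω) ∂P with hI
  have hκ8le : κ ≤ 8 := hκ8.le
  have hσ := isStoppingTime_sleStarTime (κ := κ) (S := S) (n := n) hz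
  have hσρ : ∀ ω, σs ω ≤ slePointLocTime κ z n ω := sleStarTime_le_locTime
  have hwc : ∀ ω, Continuous fun t ↦ w t ω := continuous_sleStopSlope hz hσρ
  have hwa : StronglyAdapted brownianFiltration w := stronglyAdapted_sleStopSlope hz hσ
  have hwp : IsStronglyProgressive brownianFiltration w := isStronglyProgressive_sleStopSlope hz hσ hσρ
  have hGm : MeasurableSet G := hG.1
  have hTne : ∀ ω, T ω ≠ ⊤ := fun ω ↦ ne_top_of_le_ne_top (sleStarTime_ne_top ω) (hTσ ω)
  have hI0 : 0 ≤ I := setIntegral_nonneg hGm fun ω _ ↦ (ghatC_mem_Ioc hκ hκ8le _).1.le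
  -- levels and passage times
  set ℓ : ℕ → ℝ := fun i ↦ (2 : ℝ) ^ (k + 1 - i) with hℓ
  have hℓpos : ∀ i, 0 < ℓ i := fun i ↦ by positivity
  have hℓanti : ∀ i, ℓ (i + 1) ≤ ℓ i := fun i ↦
    pow_le_pow_right₀ (by norm_num) (by omega)
  have hℓk : ℓ k = 2 := by simp [hℓ]
  have hℓsucc : ∀ i, i < k → ℓ (i + 1) = (2 : ℝ) ^ (k - i) := fun i hi ↦ by
    simp only [hℓ]; congr 1; omega
  have hℓeq : ∀ i, i < k → ℓ i = (2 : ℝ) ^ (k - i + 1) := fun i hi ↦ by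
    simp only [hℓ]; congr 1; omega
  set τ : ℕ → (ℝ≥0 → ℝ) → WithTop ℝ≥0 := fun i ↦ hittingFrom w (Set.Icc (-ℓ i) (ℓ i)) T with hτ
  have hτst : ∀ i, IsStoppingTime brownianFiltration (τ i) := fun i ↦
    isStoppingTime_hittingFrom (fun t ↦ (hwa t).measurable) hwc isClosed_Icc hT
  have hτmono : ∀ i ω, τ i ω ≤ τ (i + 1) ω := fun i ω ↦
    hittingFrom_anti (Set.Icc_subset_Icc (neg_le_neg (hℓanti i)) (hℓanti i))
  have hTτ : ∀ i ω, T ω ≤ τ i ω := fun i ω ↦ le_hittingFrom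
  have hτ0 : ∀ ω ∈ G, τ 0 ω = T ω := fun ω hω ↦ by
    refine hittingFrom_eq_self_of_mem (hTne ω) (abs_le.1 ?_)
    have := hGk hω
    simp only [hℓ, Nat.sub_zero, Set.mem_setOf_eq] at this ⊢
    exact this.le
  have havoid : ∀ ω i (r : ℝ≥0), T ω ≤ r → (r : WithTop ℝ≥0) < τ (i + 1) ω → ℓ (i + 1) ≤ |w r ω| := by
    intro ω i r hTr hr
    have h := notMem_of_lt_hittingFrom (u := w) (s := Set.Icc (-ℓ (i + 1)) (ℓ (i + 1))) hTr hr
    rw [Set.mem_Icc, ← abs_le, not_le] at h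
    exact h.le
  -- the stopping times `Tᵢ = τᵢ ∧ σ⋆` and the occupations
  set Tm : ℕ → (ℝ≥0 → ℝ) → WithTop ℝ≥0 := fun i ω ↦ min (τ i ω) (σs ω) with hTm
  have hTmst : ∀ i, IsStoppingTime brownianFiltration (Tm i) := fun i ↦ (hτst i).min hσ
  have hTmσ : ∀ i ω, Tm i ω ≤ σs ω := fun i ω ↦ min_le_right _ _
  have hTTm : ∀ i ω, T ω ≤ Tm i ω := fun i ω ↦ le_min (hTτ i ω) (hTσ ω)
  set c : ℕ → ℝ := fun i ↦ occThreshold κ (k - i) with hc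
  have hc0 : ∀ i, 0 ≤ c i := fun i ↦ occThreshold_nonneg hκ hκ8 _
  set Ret : Set (ℝ≥0 → ℝ) := {ω | τ k ω ≠ ⊤} with hRet
  set E : ℕ → Set (ℝ≥0 → ℝ) := fun i ↦ {ω | τ i ω ≠ ⊤} ∩
    {ω | c i ≤ sleOccAfter κ z S n (ℓ (i + 1)) (Tm i) ω} with hE
  -- Step 1: the inclusion
  have hincl : G ∩ sleGrowEvent κ z S n T ⊆ (G ∩ Ret) ∪ ⋃ i ∈ Finset.range k, (G ∩ E i) := by
    rintro ω ⟨hωG, t, hTt, htσ, hgrow⟩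
    by_cases hret : τ k ω ≠ ⊤
    · exact Or.inl ⟨hωG, hret⟩
    rw [not_ne_iff] at hret
    refine Or.inr ?_
    -- `R ≤ ∫_T^t Λ`
    have hψ1 : ∀ s, 1 ≤ ψ s ω := fun s ↦ one_le_stoppedProcess_slePointPsi hz hσρ s ω
    have hlog : R ≤ ∫ r in (((T ω).untopA : ℝ≥0) : ℝ)..(t : ℝ), sleLogRate κ z S n r.toNNReal ω := by
      have hTt' : (T ω).untopA ≤ t := by
        have := untopA_le_untopA_of_le hTt WithTop.coe_ne_top
        rw [untopA_coe] at this; exact_mod_cast this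
      rw [← log_sleStarPsi_sub_eq hz hTt' htσ]
      have h1 : Real.exp R ≤ ψ t ω / ψ (T ω).untopA ω := by
        rw [le_div_iff₀ (zero_lt_one.trans_le (hψ1 _))]; exact hgrow
      have h2 := Real.log_le_log (Real.exp_pos R) h1
      rw [Real.log_exp, Real.log_div (zero_lt_one.trans_le (hψ1 _)).ne' (zero_lt_one.trans_le (hψ1 _)).ne'] at h2
      exact h2
    have hsumc : ∑ i ∈ Finset.range k, c i ≤ R := by
      simp only [hc]
      rw [sum_range_sub_eq_sum_Icc]
      exact sum_occThreshold_le hκ hκ8 k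
    obtain ⟨i, hi, hne, hit, hocc⟩ := exists_occupation_ge (κ := κ) (z := z) (S := S) (n := n) hz hTt htσ
      hlog (τ := fun i ↦ τ i ω) (hτ0 ω hωG) (fun i ↦ hτmono i ω) hret (ℓ := ℓ) hℓpos
      (fun i _ r hTr hr ↦ havoid ω i r hTr hr) hc0 hsumc
    refine Set.mem_iUnion₂.2 ⟨i, Finset.mem_range.2 hi, hωG, hne, ?_⟩
    -- the occupation after `Tᵢ = τᵢ` (as `τᵢ ≤ t ≤ σ⋆`)
    have hTmi : Tm i ω = τ i ω := min_eq_left (hit.trans htσ)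
    show c i ≤ sleOccAfter κ z S n (ℓ (i + 1)) (Tm i) ω
    rw [sleOccAfter_eq_integral (T := Tm i) (hTmσ i), hTmi]
    exact hocc
  -- Step 2: the return term
  have hRetb : P.real (G ∩ Ret) ≤ (ghatC κ (ℓ k))⁻¹ * I := by
    have h : ghatC κ (ℓ k) * P.real (G ∩ Ret) ≤ I :=
      measureReal_inter_hit_le (n := n) hκ hκ8 hz h0 hT hTσ hG (ℓ k)
    have h2 := (ghatC_mem_Ioc hκ hκ8le (ℓ k)).1
    rw [inv_mul_eq_div, le_div_iff₀ h2, mul_comm]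
    exact h
  -- Step 3: the band terms
  have hEb : ∀ i ∈ Finset.range k, P.real (G ∩ E i) ≤ 2 * ((4 : ℝ) ^ (k - i))⁻¹ * I := by
    intro i hi
    rw [Finset.mem_range] at hi
    have hTmTop : ∀ ω, τ i ω ≠ ⊤ ↔ τ i ω ≤ σs ω := fun ω ↦
      ⟨hittingFrom_le_sleStarTime_of_ne_top hz (hTσ ω) isClosed_Icc,
        fun h ↦ ne_top_of_le_ne_top (sleStarTime_ne_top ω) h⟩
    -- `G' = G ∩ {τᵢ ≠ ⊤} ∈ 𝓕_{Tᵢ}`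
    have hG' : MeasurableSet[(hTmst i).measurableSpace] (G ∩ {ω | τ i ω ≠ ⊤}) := by
      refine MeasurableSet.inter (IsStoppingTime.measurableSpace_mono hT (hTmst i) (hTTm i) _ hG) ?_
      have h1 := IsStoppingTime.measurableSet_stopping_time_le_min (hτst i) hσ
      have heq : {ω | τ i ω ≠ ⊤} = {ω | τ i ω ≤ σs ω} := Set.ext fun ω ↦ hTmTop ω
      rw [heq]; exact h1
    have hℓ1 : 0 < ℓ (i + 1) := hℓpos _
    have hocc := measureReal_inter_occupation_le (n := n) hκ hκ8 hz h0 (hTmst i) (hTmσ i) hG' hℓ1 (c i)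
    have hhit := measureReal_inter_hit_le (n := n) hκ hκ8 hz h0 hT hTσ hG (ℓ i)
    have hGpos := (ghatC_mem_Ioc hκ hκ8le (ℓ i)).1
    have hexp := Real.exp_pos (occRateConst κ (ℓ (i + 1)) * c i)
    -- `P(G ∩ Eᵢ) ≤ 2 e^{-μc} P(G')`
    have h1 : P.real (G ∩ E i) ≤ 2 * Real.exp (-(occRateConst κ (ℓ (i + 1)) * c i)) *
        P.real (G ∩ {ω | τ i ω ≠ ⊤}) := by
      have hset : G ∩ E i = G ∩ {ω | τ i ω ≠ ⊤} ∩ {ω | c i ≤ sleOccAfter κ z S n (ℓ (i + 1)) (Tm i) ω} := by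
        simp only [hE]; rw [Set.inter_assoc]
      rw [hset]
      have h := mul_le_mul_of_nonneg_left hocc (Real.exp_pos (-(occRateConst κ (ℓ (i + 1)) * c i))).le
      rw [← mul_assoc, ← Real.exp_add, neg_add_cancel, Real.exp_zero, one_mul] at h
      have h' : P.real (G ∩ {ω | τ i ω ≠ ⊤} ∩ {ω | c i ≤ sleOccAfter κ z S n (ℓ (i + 1)) (Tm i) ω}) ≤
          Real.exp (-(occRateConst κ (ℓ (i + 1)) * c i)) * (2 * P.real (G ∩ {ω | τ i ω ≠ ⊤})) := h
      linarith
    -- `P(G') ≤ Ĝ(ℓᵢ)⁻¹ I`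
    have h2 : P.real (G ∩ {ω | τ i ω ≠ ⊤}) ≤ (ghatC κ (ℓ i))⁻¹ * I := by
      rw [inv_mul_eq_div, le_div_iff₀ hGpos, mul_comm]; exact hhit
    have h3 : 2 * Real.exp (-(occRateConst κ (ℓ (i + 1)) * c i)) * (ghatC κ (ℓ i))⁻¹ ≤
        2 * ((4 : ℝ) ^ (k - i))⁻¹ := by
      rw [hℓsucc i hi, hℓeq i hi]
      exact band_cost_le hκ hκ8 (k - i)
    calc P.real (G ∩ E i) ≤ 2 * Real.exp (-(occRateConst κ (ℓ (i + 1)) * c i)) *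
          P.real (G ∩ {ω | τ i ω ≠ ⊤}) := h1
      _ ≤ 2 * Real.exp (-(occRateConst κ (ℓ (i + 1)) * c i)) * ((ghatC κ (ℓ i))⁻¹ * I) :=
          mul_le_mul_of_nonneg_left h2 (by positivity)
      _ = 2 * Real.exp (-(occRateConst κ (ℓ (i + 1)) * c i)) * (ghatC κ (ℓ i))⁻¹ * I := by ring
      _ ≤ 2 * ((4 : ℝ) ^ (k - i))⁻¹ * I := mul_le_mul_of_nonneg_right h3 hI0
  -- Step 4: sum
  have hsum : ∑ i ∈ Finset.range k, 2 * ((4 : ℝ) ^ (k - i))⁻¹ * I ≤ 1 * I := by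
    rw [← Finset.sum_mul]
    refine mul_le_mul_of_nonneg_right ?_ hI0
    rw [← Finset.mul_sum, sum_range_sub_eq_sum_Icc (fun m ↦ ((4 : ℝ) ^ m)⁻¹)]
    have := sum_Icc_inv_four_pow_le k
    linarith
  calc P.real (G ∩ sleGrowEvent κ z S n T)
      ≤ P.real ((G ∩ Ret) ∪ ⋃ i ∈ Finset.range k, (G ∩ E i)) := measureReal_mono hincl
    _ ≤ P.real (G ∩ Ret) + P.real (⋃ i ∈ Finset.range k, (G ∩ E i)) := measureReal_union_le _ _
    _ ≤ P.real (G ∩ Ret) + ∑ i ∈ Finset.range k, P.real (G ∩ E i) :=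
        add_le_add le_rfl (measureReal_biUnion_finset_le _ _)
    _ ≤ (ghatC κ (ℓ k))⁻¹ * I + ∑ i ∈ Finset.range k, 2 * ((4 : ℝ) ^ (k - i))⁻¹ * I :=
        add_le_add hRetb (Finset.sum_le_sum hEb)
    _ ≤ (ghatC κ (ℓ k))⁻¹ * I + 1 * I := add_le_add le_rfl hsum
    _ = ((ghatC κ 2)⁻¹ + 1) * I := by rw [hℓk]; ring

/-- **The conditional boundary lemma.** For `0 < κ < 8`, `z ∈ ℍ`, `|w₀| < S`, a stopping time
`T ≤ σ⋆` and `G ∈ 𝓕_T`: `P(G ∩ {ψ grows by e^R at some time of [T, σ⋆]}) ≤ (Ĝ(2)⁻¹ + 1) ∫_G Ĝ(w_T) dP`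
(`measureReal_class_grow_le` with `2^{k+1} > S ≥ |w|`). This is the formal substitute for the
boundary behaviour `P_θ(S > 1) ≲ sin(θ/2)^{8/κ-1}` of Beffara's killed diffusion.
[folklore] -/
theorem measureReal_inter_grow_le (hκ : 0 < κ) (hκ8 : κ < 8) (hz : 0 < z.im) (h0 : |z.re / z.im| < S)
    {T : (ℝ≥0 → ℝ) → WithTop ℝ≥0} (hT : IsStoppingTime brownianFiltration T)
    (hTσ : ∀ ω, T ω ≤ sleStarTime κ z S n ω) {G : Set (ℝ≥0 → ℝ)}
    (hG : MeasurableSet[hT.measurableSpace] G) :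
    preWienerMeasure.real (G ∩ sleGrowEvent κ z S n T) ≤
      ((ghatC κ 2)⁻¹ + 1) * ∫ ω in G, ghatC κ (sleStarSlope κ z S n (T ω).untopA ω) ∂preWienerMeasure := by
  obtain ⟨k, hk⟩ := pow_unbounded_of_one_lt S (by norm_num : (1 : ℝ) < 2)
  refine measureReal_class_grow_le (k := k) hκ hκ8 hz h0 hT hTσ hG fun ω _ ↦ ?_
  have h1 : |sleStarSlope κ z S n (T ω).untopA ω| ≤ S :=
    abs_sleStopSlope_le hz sleStarTime_le_locTime (abs_cotArg_le_of_le_sleStarTime hz h0) _ ω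
  exact h1.trans_lt (hk.trans_le (pow_le_pow_right₀ (by norm_num) (Nat.le_succ k)))

end Grow

/-! ### The levels `e^{Rj}`: induction -/

section Levels

variable {κ : ℝ≥0} {z : ℂ} {S : ℝ} {n : ℕ}

/-- The hitting event `{H_λ ≤ σ⋆}`: `ψ` reaches `λ` along `[0, σ⋆]`. [folklore] -/
abbrev slePsiHitEvent (κ : ℝ≥0) (z : ℂ) (S lam : ℝ) (n : ℕ) : Set (ℝ≥0 → ℝ) :=
  {ω | slePsiHitTime κ z lam n ω ≤ sleStarTime κ z S n ω}

/-- `{H_λ ≤ σ⋆} ∈ 𝓕_{H_λ ∧ σ⋆}`. [folklore] -/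
theorem measurableSet_slePsiHitEvent (hz : 0 < z.im) (lam : ℝ) :
    MeasurableSet[(isStoppingTime_sleTailTime (κ := κ) hz S lam n).measurableSpace]
      (slePsiHitEvent κ z S lam n) :=
  IsStoppingTime.measurableSet_stopping_time_le_min (isStoppingTime_slePsiHitTime hz lam n)
    (isStoppingTime_sleStarTime hz)

/-- On `{H_λ ≤ σ⋆}`: `ψ` at `H_λ ∧ σ⋆` is at least `λ`. [folklore] -/
theorem le_sleStarPsi_tailTime (hz : 0 < z.im) {lam : ℝ} {ω : ℝ≥0 → ℝ}
    (hω : ω ∈ slePsiHitEvent κ z S lam n) :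
    lam ≤ sleStarPsi κ z S n (sleTailTime κ z S lam n ω).untopA ω := by
  have hσρ : ∀ ω, sleStarTime κ z S n ω ≤ slePointLocTime κ z n ω := sleStarTime_le_locTime
  have hle : slePsiHitTime κ z lam n ω ≤ sleStarTime κ z S n ω := hω
  have hT : sleTailTime κ z S lam n ω = slePsiHitTime κ z lam n ω := min_eq_left hle
  have hne : slePsiHitTime κ z lam n ω ≠ ⊤ := ne_top_of_le_ne_top (sleStarTime_ne_top ω) hle
  obtain ⟨h₀, hh₀⟩ := WithTop.ne_top_iff_exists.1 hne
  have hmem := mem_of_hittingAfter_zero_eq_coe isClosed_Ici (continuous_slePsiGauge hz lam n ω) hh₀.symm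
  simp only [Set.mem_Ici, slePsiGauge, sub_nonneg] at hmem
  have hh₀' : (sleTailTime κ z S lam n ω).untopA = h₀ := by rw [hT, ← hh₀]; rfl
  rw [hh₀']
  -- `ψ^{σ⋆}` and `ψ^{ρₙ}` agree at `h₀ ≤ σ⋆ ≤ ρₙ`
  have h1 : ((h₀ : ℝ≥0) : WithTop ℝ≥0) ≤ sleStarTime κ z S n ω := by rw [hh₀]; exact hle
  have h2 : ((h₀ : ℝ≥0) : WithTop ℝ≥0) ≤ slePointLocTime κ z n ω := h1.trans (hσρ ω)
  rw [show sleStarPsi κ z S n h₀ ω = slePointPsi κ z h₀ ω from stoppedProcess_eq_of_le h1]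
  rwa [stoppedProcess_eq_of_le h2] at hmem

/-- **The martingale step**: `∫_{H_λ ≤ σ⋆} Ĝ(w_{H_λ ∧ σ⋆}) ≤ λ^{-(1-κ/8)} Ĝ(x/y)` for `λ ≥ 1`, `|w₀| < S`
(on the event `ψ_{H} ≥ λ`, so `Ĝ(w_H) ≤ λ^{-a} ψ_H^a Ĝ(w_H) = λ^{-a} M_H`, and `E[M_H] = Ĝ(x/y)`,
`integral_stoppedProcess_critical`). [cite: RohdeSchramm2005, Lemma 6.3 (proof)] -/
theorem setIntegral_ghatC_tailTime_le (hκ : 0 < κ) (hκ8 : κ < 8) (hz : 0 < z.im) (h0 : |z.re / z.im| < S)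
    {lam : ℝ} (hlam : 1 ≤ lam) :
    ∫ ω in slePsiHitEvent κ z S lam n, ghatC κ (sleStarSlope κ z S n (sleTailTime κ z S lam n ω).untopA ω)
        ∂preWienerMeasure ≤ lam ^ (-(1 - (κ : ℝ) / 8)) * ghatC κ (z.re / z.im) := by
  haveI := isProbabilityMeasure_preWienerMeasure'
  set P := preWienerMeasure with hP
  set a : ℝ := 1 - (κ : ℝ) / 8 with ha
  set A := slePsiHitEvent κ z S lam n with hA
  set Tt := sleTailTime κ z S lam n with hTt
  set M : (ℝ≥0 → ℝ) → ℝ := fun ω ↦ stoppedProcess (sleRSObservable κ a z) Tt ((n : ℝ≥0) + 1) ω with hM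
  have hκ8le : κ ≤ 8 := hκ8.le
  have hκ8' : (κ : ℝ) ≤ 8 := by exact_mod_cast hκ8le
  have ha0 : 0 ≤ a := by rw [ha]; linarith
  have hlam0 : 0 < lam := zero_lt_one.trans_le hlam
  have hσρ : ∀ ω, sleStarTime κ z S n ω ≤ slePointLocTime κ z n ω := sleStarTime_le_locTime
  have hTtσ : ∀ ω, Tt ω ≤ sleStarTime κ z S n ω := fun ω ↦ min_le_right _ _
  have hTst := isStoppingTime_sleTailTime (κ := κ) hz S lam n
  have hAm : MeasurableSet A := (measurableSet_slePsiHitEvent (κ := κ) (S := S) (n := n) hz lam).1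
  -- `M = ψ_T^a Ĝ(w_T)` pathwise
  have hMeq : ∀ ω, M ω = sleStarPsi κ z S n (Tt ω).untopA ω ^ a * ghatC κ (sleStarSlope κ z S n (Tt ω).untopA ω) := by
    intro ω
    have h1 := stoppedProcess_critical_succ_eq (κ := κ) (z := z) (s := S) (lam := lam) (n := n) hz (u := (Tt ω).untopA)
      (by rw [coe_untopA_of_ne_top (sleTailTime_ne_top ω)])
    rw [hM]
    show stoppedProcess (sleRSObservable κ (1 - (κ : ℝ) / 8) z) (sleTailTime κ z S lam n) ((n : ℝ≥0) + 1) ω = _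
    rw [h1]
    have hmin : min (((Tt ω).untopA : ℝ≥0) : WithTop ℝ≥0) (sleStarTime κ z S n ω) = Tt ω := by
      rw [coe_untopA_of_ne_top (sleTailTime_ne_top ω), min_eq_left (hTtσ ω)]
    congr 1
    · rw [show sleStarPsi κ z S n (Tt ω).untopA ω = slePointPsi κ z ((min (((Tt ω).untopA : ℝ≥0) : WithTop ℝ≥0)
        (sleStarTime κ z S n ω)).untopA) ω from rfl, hmin, slePointPsi_apply]
    · symm
      show rsGhatSlope _ _ (sleStopSlope κ z (sleStarTime κ z S n) (Tt ω).untopA ω) = _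
      rw [sleStopSlope_eq_cotArg hz hσρ, hmin]
  -- `E[M] = Ĝ(x/y)` and `M ≥ 0`
  have hEM : ∫ ω, M ω ∂P = ghatC κ (z.re / z.im) := integral_stoppedProcess_critical hκ hz h0 lam n _
  have hM0 : ∀ ω, 0 ≤ M ω := fun ω ↦ by
    rw [hMeq]
    exact mul_nonneg (Real.rpow_nonneg (zero_le_one.trans (one_le_stoppedProcess_slePointPsi hz hσρ _ ω)) _)
      (ghatC_mem_Ioc hκ hκ8le _).1.le
  have hMint : Integrable M P := (martingale_stoppedProcess_critical hκ hz h0 lam n).integrable _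
  -- on `A`: `Ĝ(w_T) ≤ λ^{-a} M`
  have hbound : ∀ ω ∈ A, ghatC κ (sleStarSlope κ z S n (Tt ω).untopA ω) ≤ lam ^ (-a) * M ω := by
    intro ω hω
    have hψ := le_sleStarPsi_tailTime (κ := κ) (S := S) (n := n) hz hω
    have hG0 := (ghatC_mem_Ioc hκ hκ8le (sleStarSlope κ z S n (Tt ω).untopA ω)).1.le
    rw [hMeq, ← mul_assoc]
    have h1 : 1 ≤ lam ^ (-a) * sleStarPsi κ z S n (Tt ω).untopA ω ^ a := by
      rw [Real.rpow_neg hlam0.le, inv_mul_eq_div, le_div_iff₀ (Real.rpow_pos_of_pos hlam0 _), one_mul]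
      exact Real.rpow_le_rpow hlam0.le hψ ha0
    exact le_mul_of_one_le_left hG0 h1
  calc ∫ ω in A, ghatC κ (sleStarSlope κ z S n (Tt ω).untopA ω) ∂P
      ≤ ∫ ω in A, lam ^ (-a) * M ω ∂P := by
        refine setIntegral_mono_on ?_ (hMint.const_mul _).integrableOn hAm hbound
        refine Integrable.integrableOn (Integrable.of_bound ?_ 1 (ae_of_all _ fun ω ↦ ?_))
        · exact (contDiff_ghatC.continuous.measurable.comp (measurable_stoppedValue'
            (isStronglyProgressive_sleStopSlope hz (isStoppingTime_sleStarTime hz) hσρ) hTst)).aestronglyMeasurable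
        · rw [Real.norm_eq_abs, abs_of_pos (ghatC_mem_Ioc hκ hκ8le _).1]
          exact (ghatC_mem_Ioc hκ hκ8le _).2
    _ ≤ ∫ ω, lam ^ (-a) * M ω ∂P :=
        setIntegral_le_integral (hMint.const_mul _) (ae_of_all _ fun ω ↦
          mul_nonneg (Real.rpow_nonneg hlam0.le _) (hM0 ω))
    _ = lam ^ (-a) * ghatC κ (z.re / z.im) := by rw [MeasureTheory.integral_const_mul, hEM]

/-- **The step**: `P(H_{λ e^R} ≤ σ⋆) ≤ (Ĝ(2)⁻¹ + 1) λ^{-(1-κ/8)} Ĝ(x/y)` for `λ ≥ 1`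
(`{H_{λe^R} ≤ σ⋆} ⊆ {H_λ ≤ σ⋆} ∩ {growth by e^R after H_λ ∧ σ⋆}`, then `measureReal_inter_grow_le` and
`setIntegral_ghatC_tailTime_le`). [folklore] -/
theorem measureReal_slePsiHitEvent_mul_exp_le (hκ : 0 < κ) (hκ8 : κ < 8) (hz : 0 < z.im)
    (h0 : |z.re / z.im| < S) {lam : ℝ} (hlam : 1 ≤ lam) :
    preWienerMeasure.real (slePsiHitEvent κ z S (lam * Real.exp (growConst κ)) n) ≤
      ((ghatC κ 2)⁻¹ + 1) * (lam ^ (-(1 - (κ : ℝ) / 8)) * ghatC κ (z.re / z.im)) := by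
  haveI := isProbabilityMeasure_preWienerMeasure'
  set P := preWienerMeasure with hP
  set R := growConst κ with hR
  set Tt := sleTailTime κ z S lam n with hTt
  set A := slePsiHitEvent κ z S lam n with hA
  have hσρ : ∀ ω, sleStarTime κ z S n ω ≤ slePointLocTime κ z n ω := sleStarTime_le_locTime
  have hTst := isStoppingTime_sleTailTime (κ := κ) hz S lam n
  have hTtσ : ∀ ω, Tt ω ≤ sleStarTime κ z S n ω := fun ω ↦ min_le_right _ _
  have hAT : MeasurableSet[hTst.measurableSpace] A := measurableSet_slePsiHitEvent hz lam
  have hlam0 : 0 < lam := zero_lt_one.trans_le hlam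
  -- the inclusion
  have hincl : slePsiHitEvent κ z S (lam * Real.exp R) n ⊆ A ∩ sleGrowEvent κ z S n Tt := by
    intro ω hω
    have hle : slePsiHitTime κ z (lam * Real.exp R) n ω ≤ sleStarTime κ z S n ω := hω
    have hne : slePsiHitTime κ z (lam * Real.exp R) n ω ≠ ⊤ := ne_top_of_le_ne_top (sleStarTime_ne_top ω) hle
    obtain ⟨t, ht⟩ := WithTop.ne_top_iff_exists.1 hne
    have hmem := mem_of_hittingAfter_zero_eq_coe isClosed_Ici (continuous_slePsiGauge hz _ n ω) ht.symm
    simp only [Set.mem_Ici, slePsiGauge, sub_nonneg] at hmem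
    have htσ : ((t : ℝ≥0) : WithTop ℝ≥0) ≤ sleStarTime κ z S n ω := by rw [ht]; exact hle
    -- `H_λ ≤ t`
    have hHt : slePsiHitTime κ z lam n ω ≤ t := by
      refine hittingAfter_le_of_mem bot_le ?_
      simp only [Set.mem_Ici, slePsiGauge, sub_nonneg]
      have : lam ≤ lam * Real.exp R := le_mul_of_one_le_right hlam0.le (Real.one_le_exp (growConst_pos hκ hκ8).le)
      exact this.trans hmem
    have hωA : ω ∈ A := hHt.trans htσ
    refine ⟨hωA, t, (min_le_left _ _).trans hHt, htσ, ?_⟩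
    -- `e^R ψ_{Tt} ≤ ψ_t`: `ψ_{Tt} = λ`... we only know `ψ_{Tt} ≤ λ`? No: we use `ψ_{Tt} ≤ ψ` before? Use `ψ_{H} ≤ λ`:
    -- before `H_λ` the gauge is negative, and at `H_λ` (a hitting time from below, `ψ₀ = 1 ≤ λ`) `ψ = λ`.
    have hψT : sleStarPsi κ z S n (Tt ω).untopA ω ≤ lam := by
      have hTeq : Tt ω = slePsiHitTime κ z lam n ω := min_eq_left hωA
      have hneH : slePsiHitTime κ z lam n ω ≠ ⊤ := ne_top_of_le_ne_top WithTop.coe_ne_top hHt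
      obtain ⟨h₀, hh₀⟩ := WithTop.ne_top_iff_exists.1 hneH
      have hh₀' : (Tt ω).untopA = h₀ := by rw [hTeq, ← hh₀]; rfl
      rw [hh₀']
      have h1 : ((h₀ : ℝ≥0) : WithTop ℝ≥0) ≤ sleStarTime κ z S n ω := by rw [hh₀]; exact hωA
      rw [show sleStarPsi κ z S n h₀ ω = stoppedProcess (slePointPsi κ z) (slePointLocTime κ z n) h₀ ω by
        rw [show sleStarPsi κ z S n h₀ ω = slePointPsi κ z h₀ ω from stoppedProcess_eq_of_le h1,
          stoppedProcess_eq_of_le (h1.trans (hσρ ω))]]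
      -- values before `H` are `< λ`; pass to the limit `s ↑ h₀` (or `h₀ = 0`)
      rcases eq_or_ne h₀ 0 with h00 | h00
      · subst h00
        rw [stoppedProcess_eq_of_le (by exact bot_le)]
        have : slePointPsi κ z 0 ω = 1 := by
          rw [slePointPsi_apply]; exact derivRatio_zero (continuous_sleDriving κ ω) hz
        rw [this]; exact hlam
      · have hcont := continuous_stoppedProcess_slePointPsi hz (σ := slePointLocTime κ z n) (fun _ ↦ le_rfl) ω
        have hlt : ∀ s : ℝ≥0, s < h₀ → stoppedProcess (slePointPsi κ z) (slePointLocTime κ z n) s ω < lam :=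
          fun s hs ↦ stoppedProcess_slePointPsi_lt_of_lt_psiHitTime (by rw [← hh₀]; exact WithTop.coe_lt_coe.2 hs)
        have h0pos : (0 : ℝ) < h₀ := by
          have : (0 : ℝ≥0) < h₀ := pos_iff_ne_zero.2 h00
          exact_mod_cast this
        have hF : ContinuousAt (fun x : ℝ ↦ stoppedProcess (slePointPsi κ z) (slePointLocTime κ z n) x.toNNReal ω)
            (h₀ : ℝ) := (hcont.comp continuous_real_toNNReal).continuousAt
        have hev : ∀ᶠ x in 𝓝[<] ((h₀ : ℝ≥0) : ℝ),
            stoppedProcess (slePointPsi κ z) (slePointLocTime κ z n) x.toNNReal ω ≤ lam := by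
          filter_upwards [Ioo_mem_nhdsLT h0pos] with x hx
          refine (hlt _ ?_).le
          rw [← NNReal.coe_lt_coe, Real.coe_toNNReal _ hx.1.le]
          exact hx.2
        have hlim := le_of_tendsto (hF.tendsto.mono_left nhdsWithin_le_nhds) hev
        simpa using hlim
    have := mul_le_mul_of_nonneg_left hψT (Real.exp_pos R).le
    calc Real.exp R * sleStarPsi κ z S n (Tt ω).untopA ω ≤ Real.exp R * lam := this
      _ = lam * Real.exp R := mul_comm _ _
      _ ≤ stoppedProcess (slePointPsi κ z) (slePointLocTime κ z n) t ω := hmem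
      _ = sleStarPsi κ z S n t ω := by
          rw [show sleStarPsi κ z S n t ω = slePointPsi κ z t ω from stoppedProcess_eq_of_le htσ,
            stoppedProcess_eq_of_le (htσ.trans (hσρ ω))]
  calc P.real (slePsiHitEvent κ z S (lam * Real.exp R) n) ≤ P.real (A ∩ sleGrowEvent κ z S n Tt) :=
        measureReal_mono hincl
    _ ≤ ((ghatC κ 2)⁻¹ + 1) * ∫ ω in A, ghatC κ (sleStarSlope κ z S n (Tt ω).untopA ω) ∂P :=
        measureReal_inter_grow_le hκ hκ8 hz h0 hTst hTtσ hAT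
    _ ≤ ((ghatC κ 2)⁻¹ + 1) * (lam ^ (-(1 - (κ : ℝ) / 8)) * ghatC κ (z.re / z.im)) := by
        refine mul_le_mul_of_nonneg_left (setIntegral_ghatC_tailTime_le hκ hκ8 hz h0 hlam) ?_
        have := (ghatC_mem_Ioc hκ hκ8.le (2 : ℝ)).1
        positivity

/-- Lower levels are hit first: `λ' ≤ λ → {H_λ ≤ σ⋆} ⊆ {H_{λ'} ≤ σ⋆}`. [folklore] -/
theorem slePsiHitEvent_anti (hz : 0 < z.im) {lam lam' : ℝ} (h : lam' ≤ lam) :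
    slePsiHitEvent κ z S lam n ⊆ slePsiHitEvent κ z S lam' n := by
  intro ω hω
  have hle : slePsiHitTime κ z lam n ω ≤ sleStarTime κ z S n ω := hω
  have hne : slePsiHitTime κ z lam n ω ≠ ⊤ := ne_top_of_le_ne_top (sleStarTime_ne_top ω) hle
  obtain ⟨t, ht⟩ := WithTop.ne_top_iff_exists.1 hne
  have hmem := mem_of_hittingAfter_zero_eq_coe isClosed_Ici (continuous_slePsiGauge hz _ n ω) ht.symm
  simp only [Set.mem_Ici, slePsiGauge, sub_nonneg] at hmem
  have h1 : slePsiHitTime κ z lam' n ω ≤ t := by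
    refine hittingAfter_le_of_mem bot_le ?_
    simp only [Set.mem_Ici, slePsiGauge, sub_nonneg]
    exact h.trans hmem
  show slePsiHitTime κ z lam' n ω ≤ sleStarTime κ z S n ω
  exact h1.trans (by rw [ht]; exact hle)

variable (κ) in
/-- **The constant `C_κ = (Ĝ(2)⁻¹ + 1) e^{2(1-κ/8)R}`** of the sharp one-point upper estimate. [folklore] -/
def psiHitConst : ℝ := ((ghatC κ 2)⁻¹ + 1) * Real.exp (2 * (1 - (κ : ℝ) / 8) * growConst κ)

/-- `C_κ > 0`. [folklore] -/
theorem psiHitConst_pos (hκ : 0 < κ) (hκ8 : κ ≤ 8) : 0 < psiHitConst κ := by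
  have := (ghatC_mem_Ioc hκ hκ8 (2 : ℝ)).1
  unfold psiHitConst; positivity

/-- **The sharp upper bound on the levels of `ψ`, uniformly in the localisation.** For `0 < κ < 8`,
`z ∈ ℍ`, `|w₀| < S`, every `n` and every `λ ≥ e^R`:
`P(H_λ ≤ T_S ∧ ρₙ) ≤ C_κ λ^{-(1-κ/8)} Ĝ(x/y)` (`measureReal_slePsiHitEvent_mul_exp_le` at the level
`e^{Rj} ≤ λ < e^{R(j+1)}`, `j ≥ 1`). [cite: Beffara2008, Prop. 4] -/
theorem measureReal_slePsiHitEvent_le (hκ : 0 < κ) (hκ8 : κ < 8) (hz : 0 < z.im) (h0 : |z.re / z.im| < S)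
    {lam : ℝ} (hlam : Real.exp (growConst κ) ≤ lam) :
    preWienerMeasure.real (slePsiHitEvent κ z S lam n) ≤
      psiHitConst κ * lam ^ (-(1 - (κ : ℝ) / 8)) * ghatC κ (z.re / z.im) := by
  set R := growConst κ with hR
  set a : ℝ := 1 - (κ : ℝ) / 8 with ha
  have hRpos := growConst_pos hκ hκ8
  have hκ8' : (κ : ℝ) < 8 := by exact_mod_cast hκ8
  have ha0 : 0 < a := by rw [ha]; linarith
  have hlam1 : 1 ≤ lam := (Real.one_le_exp hRpos.le).trans hlam
  have hlam0 : 0 < lam := zero_lt_one.trans_le hlam1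
  -- the level `j = ⌊log λ / R⌋ ≥ 1`
  set j : ℕ := Nat.floor (Real.log lam / R) with hj
  have hlogR : 1 ≤ Real.log lam / R := by
    rw [le_div_iff₀ hRpos, one_mul]
    have := Real.log_le_log (Real.exp_pos R) hlam
    rwa [Real.log_exp] at this
  have hj1 : 1 ≤ j := Nat.le_floor (by simpa using hlogR)
  have hjle : (j : ℝ) ≤ Real.log lam / R := Nat.floor_le (zero_le_one.trans hlogR)
  have hjlt : Real.log lam / R < j + 1 := Nat.lt_floor_add_one _
  -- `e^{R(j-1)} e^R = e^{Rj} ≤ λ < e^{R(j+1)}`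
  set lam₀ : ℝ := Real.exp (R * (j - 1)) with hlam₀
  have hlam₀1 : 1 ≤ lam₀ := Real.one_le_exp (mul_nonneg hRpos.le (by
    have : (1 : ℝ) ≤ j := by exact_mod_cast hj1
    linarith))
  have hlevel : lam₀ * Real.exp R ≤ lam := by
    rw [hlam₀, ← Real.exp_add, show R * ((j : ℝ) - 1) + R = R * j by ring]
    calc Real.exp (R * j) ≤ Real.exp (Real.log lam) :=
          Real.exp_le_exp.2 (by rw [le_div_iff₀ hRpos] at hjle; linarith)
      _ = lam := Real.exp_log hlam0
  have hup : lam < Real.exp (R * (j + 1)) := by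
    calc lam = Real.exp (Real.log lam) := (Real.exp_log hlam0).symm
      _ < Real.exp (R * (j + 1)) := Real.exp_lt_exp.2 (by rw [div_lt_iff₀ hRpos] at hjlt; linarith)
  have hstep := measureReal_slePsiHitEvent_mul_exp_le (S := S) (n := n) hκ hκ8 hz h0 hlam₀1
  have hG0 := (ghatC_mem_Ioc hκ hκ8.le (z.re / z.im)).1
  have hC1 : 0 < (ghatC κ 2)⁻¹ + 1 := by have := (ghatC_mem_Ioc hκ hκ8.le (2 : ℝ)).1; positivity
  -- `λ₀^{-a} = e^{2aR} e^{-aR(j+1)} ≤ e^{2aR} λ^{-a}`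
  have hkey : lam₀ ^ (-a) ≤ Real.exp (2 * a * R) * lam ^ (-a) := by
    rw [hlam₀, ← Real.exp_mul, Real.rpow_neg hlam0.le]
    have h1 : (Real.exp (R * (j + 1))) ^ a ≥ lam ^ a := Real.rpow_le_rpow hlam0.le hup.le ha0.le
    have h2 : lam ^ a > 0 := Real.rpow_pos_of_pos hlam0 a
    have h3 : Real.exp (R * ((j : ℝ) - 1) * -a) = Real.exp (2 * a * R) * ((Real.exp (R * (j + 1))) ^ a)⁻¹ := by
      rw [← Real.exp_mul, ← Real.exp_neg, ← Real.exp_add]; congr 1; ring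
    rw [h3]
    exact mul_le_mul_of_nonneg_left (inv_anti₀ h2 h1) (Real.exp_pos _).le
  calc preWienerMeasure.real (slePsiHitEvent κ z S lam n)
      ≤ preWienerMeasure.real (slePsiHitEvent κ z S (lam₀ * Real.exp R) n) :=
        measureReal_mono (slePsiHitEvent_anti hz hlevel)
    _ ≤ ((ghatC κ 2)⁻¹ + 1) * (lam₀ ^ (-a) * ghatC κ (z.re / z.im)) := hstep
    _ ≤ ((ghatC κ 2)⁻¹ + 1) * (Real.exp (2 * a * R) * lam ^ (-a) * ghatC κ (z.re / z.im)) :=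
        mul_le_mul_of_nonneg_left (mul_le_mul_of_nonneg_right hkey hG0.le) hC1.le
    _ = psiHitConst κ * lam ^ (-a) * ghatC κ (z.re / z.im) := by
        rw [psiHitConst, ha, hR]; ring

end Levels

/-! ### Removing the localisation: the levels of `Z(z) = sup ψ` -/

section Reach

variable {κ : ℝ≥0} {z : ℂ}

/-- The exit time of `|w|` from `[0, s)` is non-decreasing in `s` (a local copy of the pointwise
form `sleCotArgExitTime_mono` of `SLEOnePointSharpUpper`, not imported here). [folklore] -/
private theorem sleCotArgExitTime_monotone (ω : ℝ≥0 → ℝ) :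
    Monotone fun s : ℝ ↦ sleCotArgExitTime κ z s ω := by
  intro s s' h
  simp only [sleCotArgExitTime, cotArgExitTime]
  exact sInf_le_sInf (Set.image_mono fun t ht ↦ ⟨ht.1, h.trans ht.2⟩)

/-- `σ⋆(N, N) = T_N ∧ ρ_N` is non-decreasing in `N`. [folklore] -/
theorem sleStarTime_diag_mono (hz : 0 < z.im) (ω : ℝ≥0 → ℝ) :
    Monotone fun N : ℕ ↦ sleStarTime κ z (N : ℝ) N ω := by
  intro N N' h
  simp only [sleStarTime, sleCotArgLocTime]
  exact min_le_min (sleCotArgExitTime_monotone ω (by exact_mod_cast h)) (slePointLocTime_mono hz ω h)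

variable (κ z) in
/-- The localised reach events `B_N = {∃ t ≤ σ⋆(N, N), ψₜ ≥ λ}` (increasing in `N`). [folklore] -/
def sleReachLoc (lam : ℝ) (N : ℕ) : Set (ℝ≥0 → ℝ) :=
  {ω | ∃ t : ℝ≥0, (t : WithTop ℝ≥0) ≤ sleStarTime κ z (N : ℝ) N ω ∧ lam ≤ derivRatio (sleDriving κ ω) z t}

/-- `B_N` is increasing in `N`. [folklore] -/
theorem monotone_sleReachLoc (hz : 0 < z.im) (lam : ℝ) : Monotone (sleReachLoc κ z lam) := by
  intro N N' h ω ⟨t, ht, hlam⟩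
  exact ⟨t, ht.trans (sleStarTime_diag_mono hz ω h), hlam⟩

/-- `B_N ⊆ {H_λ ≤ σ⋆(N, N)}`. [folklore] -/
theorem sleReachLoc_subset (lam : ℝ) (N : ℕ) :
    sleReachLoc κ z lam N ⊆ slePsiHitEvent κ z (N : ℝ) lam N := by
  rintro ω ⟨t, ht, hlam⟩
  have htρ : ((t : ℝ≥0) : WithTop ℝ≥0) ≤ slePointLocTime κ z N ω := ht.trans (sleStarTime_le_locTime ω)
  have h1 : slePsiHitTime κ z lam N ω ≤ t := by
    refine hittingAfter_le_of_mem bot_le ?_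
    simp only [Set.mem_Ici, slePsiGauge, sub_nonneg, stoppedProcess_eq_of_le htρ, slePointPsi_apply]
    exact hlam
  exact h1.trans ht

/-- **`E_λ ⊆ ⋃_N B_N`**: if `ψ` reaches `λ` at `t < τ(z)`, then `t ≤ ρ_N` for `N` large
(`exists_le_slePointLocTime`) and `|w| < N` on `[0, t]` for `N` large (continuity), so `t ≤ T_N`.
[folklore] -/
theorem sleRatioReach_subset_iUnion (hz : 0 < z.im) (lam : ℝ) :
    sleRatioReach κ z lam ⊆ ⋃ N, sleReachLoc κ z lam N := by
  rintro ω ⟨t, ht, hlam⟩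
  have hW := continuous_sleDriving κ ω
  obtain ⟨N₁, hN₁⟩ := exists_le_slePointLocTime hz ω ht
  -- bound the slope on `[0, t]`
  obtain ⟨B, hB⟩ : ∃ B, ∀ s ∈ Set.Icc (0 : ℝ≥0) t, |cotArg (sleDriving κ ω) z s| ≤ B := by
    have hcont : ContinuousOn (fun s ↦ |cotArg (sleDriving κ ω) z s|) (Set.Icc 0 t) :=
      (continuousOn_abs_cotArg hW hz).mono fun s hs ↦ lt_of_le_of_lt (WithTop.coe_le_coe.2 hs.2) ht
    obtain ⟨B, hB⟩ := isCompact_Icc.exists_bound_of_continuousOn hcont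
    exact ⟨B, fun s hs ↦ by simpa [Real.norm_eq_abs] using hB s hs⟩
  obtain ⟨N₂, hN₂⟩ := exists_nat_gt B
  refine Set.mem_iUnion.2 ⟨max N₁ N₂, t, le_min ?_ (hN₁ _ (le_max_left _ _)), hlam⟩
  -- `t ≤ T_N`: every `s < τ` with `N ≤ |w_s|` has `s > t`
  show (t : WithTop ℝ≥0) ≤ sleCotArgExitTime κ z ((max N₁ N₂ : ℕ) : ℝ) ω
  simp only [sleCotArgExitTime, cotArgExitTime]
  refine le_sInf ?_
  rintro _ ⟨s, ⟨-, hs⟩, rfl⟩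
  refine WithTop.coe_le_coe.2 (le_of_not_gt fun hst ↦ ?_)
  have h1 := hB s ⟨bot_le, hst.le⟩
  have h2 : (B : ℝ) < ((max N₁ N₂ : ℕ) : ℝ) := hN₂.trans_le (by exact_mod_cast le_max_right N₁ N₂)
  linarith

/-- **The sharp upper tail of `Z(z) = sup_{t<τ(z)} ψₜ(z)`** (Beffara (2008), Prop. 4, upper half, read on
Rohde–Schramm's ratio): for `0 < κ < 8`, `z = x + iy ∈ ℍ` and `λ ≥ e^{R_κ}`,
`P[∃ t < τ(z), ψₜ(z) ≥ λ] ≤ C_κ λ^{-(1-κ/8)} Ĝ_{1-κ/8,κ}(x/y + i)`, `Ĝ_{1-κ/8,κ}(x/y+i) = (y/|z|)^{8/κ-1}`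
(`rsGhat_critical`). Complements the lower bound `rsGhatSlope_le_rpow_mul_measureReal`
(`SLEDerivRatioTail.lean`). [cite: Beffara2008, Prop. 4] -/
theorem measureReal_sleRatioReach_le (hκ : 0 < κ) (hκ8 : κ < 8) (hz : 0 < z.im) {lam : ℝ}
    (hlam : Real.exp (growConst κ) ≤ lam) :
    preWienerMeasure.real (sleRatioReach κ z lam) ≤
      psiHitConst κ * lam ^ (-(1 - (κ : ℝ) / 8)) * rsGhatSlope (1 - (κ : ℝ) / 8) κ (z.re / z.im) := by
  haveI := isProbabilityMeasure_preWienerMeasure'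
  set P := preWienerMeasure with hP
  set bound : ℝ := psiHitConst κ * lam ^ (-(1 - (κ : ℝ) / 8)) * rsGhatSlope (1 - (κ : ℝ) / 8) κ (z.re / z.im)
    with hbound
  have hmono := monotone_sleReachLoc (κ := κ) hz lam
  have hev : ∀ᶠ N : ℕ in atTop, P (sleReachLoc κ z lam N) ≤ ENNReal.ofReal bound := by
    obtain ⟨N₀, hN₀⟩ := exists_nat_gt |z.re / z.im|
    filter_upwards [eventually_ge_atTop N₀] with N hN
    have h0 : |z.re / z.im| < (N : ℝ) := hN₀.trans_le (by exact_mod_cast hN)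
    have h1 := measureReal_slePsiHitEvent_le (S := (N : ℝ)) (n := N) hκ hκ8 hz h0 hlam
    calc P (sleReachLoc κ z lam N) ≤ P (slePsiHitEvent κ z (N : ℝ) lam N) := measure_mono (sleReachLoc_subset lam N)
      _ = ENNReal.ofReal (P.real (slePsiHitEvent κ z (N : ℝ) lam N)) :=
          (ofReal_measureReal (measure_ne_top _ _)).symm
      _ ≤ ENNReal.ofReal bound := ENNReal.ofReal_le_ofReal h1
  have hlim := tendsto_measure_iUnion_atTop (μ := P) hmono
  have hle : P (⋃ N, sleReachLoc κ z lam N) ≤ ENNReal.ofReal bound := le_of_tendsto hlim hev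
  have hbound0 : 0 ≤ bound := by
    have := psiHitConst_pos hκ hκ8.le
    have := (rsGhatSlope_critical_mem_Ioc (by exact_mod_cast hκ) (by exact_mod_cast hκ8.le) (z.re / z.im)).1
    have := Real.rpow_nonneg ((Real.one_le_exp (growConst_pos hκ hκ8).le).trans hlam |> zero_le_one.trans) (-(1 - (κ : ℝ) / 8))
    positivity
  calc P.real (sleRatioReach κ z lam) ≤ P.real (⋃ N, sleReachLoc κ z lam N) :=
        measureReal_mono (sleRatioReach_subset_iUnion hz lam)
    _ ≤ bound := by
        rw [Measure.real, ← ENNReal.toReal_ofReal hbound0]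
        exact ENNReal.toReal_mono ENNReal.ofReal_ne_top hle

end Reach

/-! ### The trace: `P[dist(z, γ) ≤ ε] ≤ C (ε/Im z)^{1-κ/8} Ĝ(x/y)` -/

section Trace

variable {κ : ℝ≥0}

/-- **`{dist(z, γ) ≤ ε} ⊆ E_{Im z/(128πε)}`** on the event that the chain is generated by a curve:
otherwise `ψ < Im z/(128πε)` on `[0, τ(z))` and (6.2) gives `dist(z, γ) ≥ 2ε`.
[cite: RohdeSchramm2005, eq. (6.2)] -/
theorem mem_sleRatioReach_of_infDist_le {z : ℂ} (hz : 0 < z.im) {ε : ℝ} (hε : 0 < ε) {ω : ℝ≥0 → ℝ}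
    (hgen : ∃ γ, IsGeneratedByCurve (sleDriving κ ω) γ) (hdist : infDist z (range (sleTrace κ ω)) ≤ ε) :
    ω ∈ sleRatioReach κ z (z.im / (128 * π * ε)) := by
  by_contra hcon
  have hM : ∀ t : ℝ≥0, (t : WithTop ℝ≥0) < swallowingTime (sleDriving κ ω) z →
      derivRatio (sleDriving κ ω) z t ≤ z.im / (128 * π * ε) := by
    intro t ht
    by_contra h
    exact hcon ⟨t, ht, (not_le.1 h).le⟩
  have hle := IsGeneratedByCurve.le_infDist_range_of_derivRatio_le (isGeneratedByCurve_trace hgen)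
    (continuous_sleDriving κ ω) hz hM
  have heq : z.im / (64 * π * (z.im / (128 * π * ε))) = 2 * ε := by
    field_simp
    ring
  rw [heq] at hle
  have : infDist z (range (sleTrace κ ω)) = infDist z (range (Loewner.trace (sleDriving κ ω))) := rfl
  linarith

/-- **The sharp one-point upper estimate for the SLE_κ trace** (Beffara (2008), Prop. 4, upper half;
Lawler (2005), Thm. 7.9, upper half, with the angular factor): for `0 < κ < 8` and SLE_κ generated by
a curve (`HasSLETrace κ`), there are `C` and `c₀ > 0` (depending only on `κ`) such that for all
`z = x + iy ∈ ℍ` and `0 < ε ≤ c₀ y`,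
`P[ dist(z, γ[0,∞)) ≤ ε ] ≤ C (ε/y)^{1-κ/8} Ĝ_{1-κ/8,κ}(x/y + i)`, `Ĝ_{1-κ/8,κ}(x/y + i) = (y/|z|)^{8/κ-1}
= (sin arg z)^{8/κ-1}`. (The measure of the possibly non-measurable event is its outer measure.)
[cite: Beffara2008, Prop. 4] -/
theorem measure_infDist_sleTrace_le_sharp (hκ : 0 < κ) (hκ8 : κ < 8) (hT : HasSLETrace κ) :
    ∃ C c₀ : ℝ, 0 < c₀ ∧ ∀ {z : ℂ}, 0 < z.im → ∀ {ε : ℝ}, 0 < ε → ε ≤ c₀ * z.im →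
      preWienerMeasure {ω | infDist z (range (sleTrace κ ω)) ≤ ε} ≤
        ENNReal.ofReal (C * (ε / z.im) ^ (1 - (κ : ℝ) / 8) * rsGhatSlope (1 - (κ : ℝ) / 8) κ (z.re / z.im)) := by
  set a : ℝ := 1 - (κ : ℝ) / 8 with ha
  set R := growConst κ with hR
  have hκ8' : (κ : ℝ) < 8 := by exact_mod_cast hκ8
  have ha0 : 0 < a := by rw [ha]; linarith
  refine ⟨psiHitConst κ * (128 * π) ^ a, (128 * π * Real.exp R)⁻¹, by positivity, fun {z} hz {ε} hε hεc ↦ ?_⟩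
  set lam : ℝ := z.im / (128 * π * ε) with hlam
  have hlam0 : 0 < lam := by positivity
  -- `λ ≥ e^R`
  have hlamR : Real.exp R ≤ lam := by
    rw [hlam, le_div_iff₀ (by positivity)]
    have h1 := mul_le_mul_of_nonneg_left hεc (by positivity : (0 : ℝ) ≤ 128 * π * Real.exp R)
    rw [← mul_assoc, mul_inv_cancel₀ (by positivity), one_mul] at h1
    calc Real.exp R * (128 * π * ε) = 128 * π * Real.exp R * ε := by ring
      _ ≤ z.im := h1
  set A : Set (ℝ≥0 → ℝ) := {ω | infDist z (range (sleTrace κ ω)) ≤ ε} with hA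
  set Good : Set (ℝ≥0 → ℝ) := {ω | ∃ γ, IsGeneratedByCurve (sleDriving κ ω) γ} with hGood
  have hGc : preWienerMeasure Goodᶜ = 0 := by
    have h : ∀ᵐ ω ∂preWienerMeasure, ω ∈ Good := hT
    exact mem_ae_iff.1 (Filter.eventually_iff.1 h)
  have hsub : A ⊆ sleRatioReach κ z lam ∪ Goodᶜ := by
    intro ω hω
    by_cases hg : ω ∈ Good
    · exact Or.inl (mem_sleRatioReach_of_infDist_le hz hε hg hω)
    · exact Or.inr hg
  have hreach := measureReal_sleRatioReach_le hκ hκ8 hz hlamR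
  -- `λ^{-a} = (128π)^a (ε/Im z)^a`
  have hq0 : 0 < z.im / (128 * π * ε) := by positivity
  have hpow : (z.im / (128 * π * ε)) ^ (-a) = (128 * π) ^ a * (ε / z.im) ^ a := by
    rw [Real.rpow_neg hq0.le, ← Real.inv_rpow hq0.le, ← Real.mul_rpow (by positivity)
      (div_nonneg hε.le hz.le)]
    congr 1
    field_simp
  have hreach' : preWienerMeasure.real (sleRatioReach κ z lam) ≤
      psiHitConst κ * (128 * π) ^ a * (ε / z.im) ^ a * rsGhatSlope a κ (z.re / z.im) := by
    refine hreach.trans_eq ?_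
    show psiHitConst κ * (z.im / (128 * π * ε)) ^ (-a) * rsGhatSlope a κ (z.re / z.im) = _
    rw [hpow]; ring
  calc preWienerMeasure A ≤ preWienerMeasure (sleRatioReach κ z lam ∪ Goodᶜ) := measure_mono hsub
    _ ≤ preWienerMeasure (sleRatioReach κ z lam) + preWienerMeasure Goodᶜ := measure_union_le _ _
    _ = preWienerMeasure (sleRatioReach κ z lam) := by rw [hGc, add_zero]
    _ = ENNReal.ofReal (preWienerMeasure.real (sleRatioReach κ z lam)) :=
        (ofReal_measureReal (measure_ne_top _ _)).symm
    _ ≤ ENNReal.ofReal (psiHitConst κ * (128 * π) ^ a * (ε / z.im) ^ a * rsGhatSlope a κ (z.re / z.im)) :=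
        ENNReal.ofReal_le_ofReal hreach'

/-- `Ĝ(x/y) = (y²/(x²+y²))^b` read on the point `Z = x + iy`. [folklore] -/
theorem rsGhatSlope_critical_eq_sq (hκ : 0 < κ) {Z : ℂ} (hZ : 0 < Z.im) :
    rsGhatSlope (1 - (κ : ℝ) / 8) κ (Z.re / Z.im) = (Z.im ^ 2 / (Z.re ^ 2 + Z.im ^ 2)) ^ ghatExp κ := by
  rw [← rsGhat_eq_rsGhatSlope _ _ hZ.ne', rsGhat_critical (by exact_mod_cast hκ) hZ.ne']
  rfl

/-- **The angular factor moves by at most `64^b` within distance `3 Im z`**: if `|ζ - z| ≤ 3 Im z`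
and `Im ζ > 0` then `Ĝ(Re ζ/Im ζ) ≤ 64^b Ĝ(Re z/Im z)` (`b = (8-κ)/(2κ)`). [folklore] -/
theorem ghat_near_le (hκ : 0 < κ) (hκ8 : κ ≤ 8) {z ζ : ℂ} (hz : 0 < z.im) (hζ : 0 < ζ.im)
    (hd : ‖ζ - z‖ ≤ 3 * z.im) :
    rsGhatSlope (1 - (κ : ℝ) / 8) κ (ζ.re / ζ.im) ≤
      (64 : ℝ) ^ ghatExp κ * rsGhatSlope (1 - (κ : ℝ) / 8) κ (z.re / z.im) := by
  have hb := ghatExp_nonneg hκ hκ8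
  rw [rsGhatSlope_critical_eq_sq hκ hζ, rsGhatSlope_critical_eq_sq hκ hz, ← Real.mul_rpow (by norm_num) (by positivity)]
  refine Real.rpow_le_rpow (by positivity) ?_ hb
  -- `Im ζ²/|ζ|² ≤ 64 y²/|z|²`
  have hnz : z.re ^ 2 + z.im ^ 2 = ‖z‖ ^ 2 := by rw [Complex.sq_norm, Complex.normSq_apply]; ring
  have hnζ : ζ.re ^ 2 + ζ.im ^ 2 = ‖ζ‖ ^ 2 := by rw [Complex.sq_norm, Complex.normSq_apply]; ring
  rw [hnz, hnζ]
  have hz0 : 0 < ‖z‖ := norm_pos_iff.2 (fun h ↦ by rw [h] at hz; simp at hz)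
  have hζ0 : 0 < ‖ζ‖ := norm_pos_iff.2 (fun h ↦ by rw [h] at hζ; simp at hζ)
  have himζ : ζ.im ≤ 4 * z.im := by
    have h1 : |(ζ - z).im| ≤ ‖ζ - z‖ := Complex.abs_im_le_norm _
    rw [Complex.sub_im] at h1
    have := (abs_le.1 (h1.trans hd)).2
    linarith
  rcases le_or_gt (6 * z.im) ‖z‖ with hcase | hcase
  · -- `|z| ≥ 6y`: `|ζ| ≥ |z|/2`
    have hζz : ‖z‖ / 2 ≤ ‖ζ‖ := by
      have := norm_sub_norm_le z ζ
      rw [norm_sub_rev] at this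
      linarith
    rw [div_le_iff₀ (by positivity)]
    calc ζ.im ^ 2 ≤ (4 * z.im) ^ 2 := pow_le_pow_left₀ hζ.le himζ 2
      _ = 64 * (z.im ^ 2 / ‖z‖ ^ 2) * (‖z‖ / 2) ^ 2 := by field_simp; ring
      _ ≤ 64 * (z.im ^ 2 / ‖z‖ ^ 2) * ‖ζ‖ ^ 2 :=
          mul_le_mul_of_nonneg_left (pow_le_pow_left₀ (by positivity) hζz 2) (by positivity)
  · -- `|z| < 6y`
    have h1 : ζ.im ^ 2 / ‖ζ‖ ^ 2 ≤ 1 := by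
      rw [div_le_one (by positivity)]
      have := Complex.abs_im_le_norm ζ
      rw [abs_of_pos hζ] at this
      exact pow_le_pow_left₀ hζ.le this 2
    have h2 : 1 ≤ 64 * (z.im ^ 2 / ‖z‖ ^ 2) := by
      rw [mul_div_assoc', le_div_iff₀ (by positivity), one_mul]
      nlinarith [hcase, hz0, hz]
    exact h1.trans h2

/-- Rounding to a grid of mesh `δ > 0`: `|u - δ·round(u/δ)| ≤ δ/2`. [folklore] -/
theorem abs_sub_mul_round_le (u : ℝ) {δ : ℝ} (hδ : 0 < δ) : |u - δ * round (u / δ)| ≤ δ / 2 := by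
  have h1 : |u / δ - ((round (u / δ) : ℤ) : ℝ)| ≤ 1 / 2 := abs_sub_round (u / δ)
  have h2 : u - δ * ((round (u / δ) : ℤ) : ℝ) = δ * (u / δ - ((round (u / δ) : ℤ) : ℝ)) := by
    rw [mul_sub, mul_div_cancel₀ _ hδ.ne']
  rw [h2, abs_mul, abs_of_pos hδ]
  calc δ * |u / δ - ((round (u / δ) : ℤ) : ℝ)| ≤ δ * (1 / 2) := mul_le_mul_of_nonneg_left h1 hδ.le
    _ = δ / 2 := by ring

/-- Index bound for the rounding: `|u - δ j| ≤ δ/2`, `|u| < L` give `δ |j| < L + δ/2`. [folklore] -/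
theorem mul_abs_lt_of_round {u δ L : ℝ} {j : ℤ} (hδ : 0 < δ) (hj : |u - δ * j| ≤ δ / 2) (hu : |u| < L) :
    δ * |(j : ℝ)| < L + δ / 2 := by
  have h1 : |δ * (j : ℝ)| ≤ |u| + δ / 2 := by
    have := abs_sub_abs_le_abs_sub (δ * j) u
    rw [abs_sub_comm] at hj
    linarith
  rw [abs_mul, abs_of_pos hδ] at h1
  linarith

set_option maxHeartbeats 400000 in
/-- **The sharp one-point upper estimate up to `ε ≤ (1-η) Im z`.** For `0 < κ < 8`, `HasSLETrace κ` and
`0 < η < 1` there is `C` with `P[dist(z, γ[0,∞)) ≤ ε] ≤ C (ε/y)^{1-κ/8} Ĝ_{1-κ/8,κ}(x/y + i)` for all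
`z = x + iy ∈ ℍ` and `0 < ε ≤ (1-η) y`. For `ε > c₁ y` (beyond `measure_infDist_sleTrace_le_sharp`), cover
the `ε`-neighbourhood of `z` by `O((c₁η)⁻²)` discs of radius `c₁ η y/4` centred at grid points `ζ` with
`Im ζ ≥ η y/2`, apply the sharp estimate at each `ζ`, and compare the angular factors (`ghat_near_le`);
this is the regime of the boundary-proximity exponent `8/κ - 1`. [cite: Beffara2008, Prop. 4] -/
theorem measure_infDist_sleTrace_le_sharp' (hκ : 0 < κ) (hκ8 : κ < 8) (hT : HasSLETrace κ) {η : ℝ}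
    (hη : 0 < η) (hη1 : η < 1) :
    ∃ C : ℝ, ∀ {z : ℂ}, 0 < z.im → ∀ {ε : ℝ}, 0 < ε → ε ≤ (1 - η) * z.im →
      preWienerMeasure {ω | infDist z (range (sleTrace κ ω)) ≤ ε} ≤
        ENNReal.ofReal (C * (ε / z.im) ^ (1 - (κ : ℝ) / 8) * rsGhatSlope (1 - (κ : ℝ) / 8) κ (z.re / z.im)) := by
  obtain ⟨C, c₀, hc₀, hmain⟩ := measure_infDist_sleTrace_le_sharp hκ hκ8 hT
  set a : ℝ := 1 - (κ : ℝ) / 8 with ha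
  have hκ8' : (κ : ℝ) < 8 := by exact_mod_cast hκ8
  have ha0 : 0 < a := by rw [ha]; linarith
  have hb := ghatExp_nonneg hκ hκ8.le
  set c₁ : ℝ := min c₀ 1 with hc₁
  have hc₁0 : 0 < c₁ := lt_min hc₀ zero_lt_one
  have hc₁c₀ : c₁ ≤ c₀ := min_le_left _ _
  have hc₁1 : c₁ ≤ 1 := min_le_right _ _
  have hGpos : ∀ Z : ℂ, 0 < rsGhatSlope (1 - (κ : ℝ) / 8) κ (Z.re / Z.im) := fun Z ↦
    (rsGhatSlope_critical_mem_Ioc (by exact_mod_cast hκ) (by exact_mod_cast hκ8.le) _).1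
  have hGle : ∀ Z : ℂ, rsGhatSlope (1 - (κ : ℝ) / 8) κ (Z.re / Z.im) ≤ 1 := fun Z ↦
    (rsGhatSlope_critical_mem_Ioc (by exact_mod_cast hκ) (by exact_mod_cast hκ8.le) _).2
  -- `C ≥ 0` may be assumed
  have hmain' : ∀ {z : ℂ}, 0 < z.im → ∀ {ε : ℝ}, 0 < ε → ε ≤ c₀ * z.im →
      preWienerMeasure {ω | infDist z (range (sleTrace κ ω)) ≤ ε} ≤
        ENNReal.ofReal (max C 0 * (ε / z.im) ^ a * rsGhatSlope (1 - (κ : ℝ) / 8) κ (z.re / z.im)) := by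
    intro z hz ε hε hεc
    refine (hmain hz hε hεc).trans (ENNReal.ofReal_le_ofReal ?_)
    exact mul_le_mul_of_nonneg_right (mul_le_mul_of_nonneg_right (le_max_left _ _)
      (Real.rpow_nonneg (div_nonneg hε.le hz.le) _)) (hGpos z).le
  -- the grid size `M` and the constant
  set M : ℕ := Nat.ceil (4 / (c₁ * η)) + 1 with hM
  set Ngrid : ℝ := ((2 * M + 1 : ℕ) : ℝ) ^ 2 with hNgrid
  set K : ℝ := Ngrid * (64 : ℝ) ^ ghatExp κ * c₁ ^ (-a) with hK
  have hK0 : 0 ≤ K := by positivity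
  have hC0 : 0 ≤ max C 0 := le_max_right _ _
  refine ⟨max C 0 * (1 + K), fun {z} hz {ε} hε hεη ↦ ?_⟩
  set y := z.im with hy
  set G₀ : ℝ := rsGhatSlope (1 - (κ : ℝ) / 8) κ (z.re / z.im) with hG₀
  have hG₀pos : 0 < G₀ := hGpos z
  by_cases hsmall : ε ≤ c₁ * y
  · -- the sharp lemma directly
    refine (hmain' hz hε (hsmall.trans (mul_le_mul_of_nonneg_right hc₁c₀ hz.le))).trans
      (ENNReal.ofReal_le_ofReal ?_)
    have h1 : max C 0 ≤ max C 0 * (1 + K) := le_mul_of_one_le_right hC0 (by linarith)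
    exact mul_le_mul_of_nonneg_right (mul_le_mul_of_nonneg_right h1
      (Real.rpow_nonneg (div_nonneg hε.le hz.le) _)) hG₀pos.le
  -- the net
  rw [not_le] at hsmall
  have hεy : ε ≤ y := hεη.trans (by nlinarith)
  set r : ℝ := c₁ * η * y / 2 with hr
  have hr0 : 0 < r := by positivity
  have hrη : r ≤ η * y / 2 := by rw [hr]; nlinarith [mul_pos hη hz]
  have hry : r ≤ y / 2 := hrη.trans (by nlinarith)
  have hyr : 2 * y / r = 4 / (c₁ * η) := by rw [hr]; field_simp; ring
  have hMge : 2 * y / r + 1 ≤ (M : ℝ) := by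
    rw [hyr, hM]; push_cast
    have := Nat.le_ceil (4 / (c₁ * η))
    linarith
  have hrM : r * M ≤ 3 * y := by
    have h1 : (M : ℝ) ≤ 4 / (c₁ * η) + 2 := by
      rw [hM]; push_cast
      have := Nat.ceil_lt_add_one (show (0 : ℝ) ≤ 4 / (c₁ * η) by positivity)
      linarith
    calc r * M ≤ r * (4 / (c₁ * η) + 2) := mul_le_mul_of_nonneg_left h1 hr0.le
      _ = 2 * y + 2 * r := by rw [← hyr]; field_simp
      _ ≤ 3 * y := by linarith
  -- grid points
  set ζ : ℤ × ℤ → ℂ := fun mn ↦ z + ((r / 2 * (mn.1 : ℝ) : ℝ) : ℂ) + ((r / 2 * (mn.2 : ℝ) : ℝ) : ℂ) * Complex.I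
    with hζ
  have hζre : ∀ mn : ℤ × ℤ, (ζ mn).re = z.re + r / 2 * mn.1 := fun mn ↦ by simp [hζ]
  have hζim : ∀ mn : ℤ × ℤ, (ζ mn).im = y + r / 2 * mn.2 := fun mn ↦ by simp [hζ, hy]
  set idx : Finset (ℤ × ℤ) := (Finset.Icc (-(M : ℤ)) M) ×ˢ (Finset.Icc (-(M : ℤ)) M) with hidx
  set idx' : Finset (ℤ × ℤ) := idx.filter (fun mn ↦ η * y / 2 ≤ (ζ mn).im) with hidx'
  have hmemidx : ∀ {m k : ℤ}, |(m : ℝ)| ≤ M → |(k : ℝ)| ≤ M → (m, k) ∈ idx := by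
    intro m k hm hk
    simp only [hidx, Finset.mem_product, Finset.mem_Icc]
    have hm' := abs_le.1 hm; have hk' := abs_le.1 hk
    exact ⟨⟨by exact_mod_cast hm'.1, by exact_mod_cast hm'.2⟩, ⟨by exact_mod_cast hk'.1, by exact_mod_cast hk'.2⟩⟩
  have hidxbd : ∀ {mn : ℤ × ℤ}, mn ∈ idx → |((mn.1 : ℤ) : ℝ)| ≤ M ∧ |((mn.2 : ℤ) : ℝ)| ≤ M := by
    intro mn h
    simp only [hidx, Finset.mem_product, Finset.mem_Icc] at h
    exact ⟨abs_le.2 ⟨by exact_mod_cast h.1.1, by exact_mod_cast h.1.2⟩,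
      abs_le.2 ⟨by exact_mod_cast h.2.1, by exact_mod_cast h.2.2⟩⟩
  -- Step 1: covering
  have hcover : {ω | infDist z (range (sleTrace κ ω)) ≤ ε} ⊆
      ⋃ mn ∈ idx', {ω | infDist (ζ mn) (range (sleTrace κ ω)) ≤ r / 2} := by
    intro ω hω
    have hne : (range (sleTrace κ ω)).Nonempty := range_nonempty _
    have hlt : infDist z (range (sleTrace κ ω)) < ε + r / 4 := lt_of_le_of_lt hω (by linarith)
    obtain ⟨q, hq, hdq⟩ := (infDist_lt_iff hne).1 hlt
    rw [dist_comm, dist_eq_norm] at hdq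
    set m : ℤ := round ((q - z).re / (r / 2)) with hm
    set k : ℤ := round ((q - z).im / (r / 2)) with hk
    have hmr : |(q - z).re - r / 2 * m| ≤ r / 2 / 2 := abs_sub_mul_round_le _ (by positivity)
    have hki : |(q - z).im - r / 2 * k| ≤ r / 2 / 2 := abs_sub_mul_round_le _ (by positivity)
    have hqre : |(q - z).re| < ε + r / 4 := (Complex.abs_re_le_norm _).trans_lt hdq
    have hqim : |(q - z).im| < ε + r / 4 := (Complex.abs_im_le_norm _).trans_lt hdq
    have hmb := mul_abs_lt_of_round (by positivity) hmr hqre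
    have hkb := mul_abs_lt_of_round (by positivity) hki hqim
    -- `|m|, |k| ≤ M` since `(ε + r/4 + r/4)/(r/2) ≤ 2y/r + 1 ≤ M`
    have hjM : ∀ {j : ℤ}, r / 2 * |(j : ℝ)| < ε + r / 4 + r / 2 / 2 → |(j : ℝ)| ≤ M := by
      intro j hj
      have h1 : r / 2 * |(j : ℝ)| ≤ y + r / 2 := by linarith
      have h2 : |(j : ℝ)| ≤ 2 * y / r + 1 := by
        rw [div_add_one hr0.ne', le_div_iff₀ hr0]; linarith
      exact h2.trans hMge
    have hmM : |(m : ℝ)| ≤ M := hjM hmb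
    have hkM : |(k : ℝ)| ≤ M := hjM hkb
    have hdist : dist (ζ (m, k)) q ≤ r / 2 := by
      rw [dist_eq_norm]
      have hre : (ζ (m, k) - q).re = -((q - z).re - r / 2 * m) := by
        rw [Complex.sub_re, hζre, Complex.sub_re]; ring
      have him : (ζ (m, k) - q).im = -((q - z).im - r / 2 * k) := by
        rw [Complex.sub_im, hζim, Complex.sub_im, hy]; ring
      calc ‖ζ (m, k) - q‖ ≤ |(ζ (m, k) - q).re| + |(ζ (m, k) - q).im| := Complex.norm_le_abs_re_add_abs_im _
        _ ≤ r / 2 / 2 + r / 2 / 2 := by rw [hre, him, abs_neg, abs_neg]; exact add_le_add hmr hki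
        _ = r / 2 := by ring
    have hhigh : η * y / 2 ≤ (ζ (m, k)).im := by
      rw [hζim]
      have h1 : -(ε + r / 4) < (q - z).im := (abs_lt.1 hqim).1
      have h2 : (q - z).im - r / 2 * k ≤ r / 2 / 2 := (abs_le.1 hki).2
      rw [Complex.sub_im] at h1 h2
      have h3 : y - ε ≥ η * y := by nlinarith
      linarith
    have hmem : (m, k) ∈ idx' := Finset.mem_filter.2 ⟨hmemidx hmM hkM, hhigh⟩
    exact Set.mem_iUnion₂.2 ⟨(m, k), hmem, (infDist_le_dist_of_mem hq).trans hdist⟩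
  -- Step 2: the bound at each grid point
  have hterm : ∀ mn ∈ idx', preWienerMeasure {ω | infDist (ζ mn) (range (sleTrace κ ω)) ≤ r / 2} ≤
      ENNReal.ofReal (max C 0 * (64 : ℝ) ^ ghatExp κ * G₀) := by
    intro mn hmn
    have himn : η * y / 2 ≤ (ζ mn).im := (Finset.mem_filter.1 hmn).2
    have hζpos : 0 < (ζ mn).im := lt_of_lt_of_le (by positivity) himn
    have hrI : r / 2 ≤ (ζ mn).im / 2 := by linarith
    have hrc : r / 2 ≤ c₀ * (ζ mn).im := by
      calc r / 2 = c₁ * (η * y / 2) / 2 := by rw [hr]; ring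
        _ ≤ c₀ * (ζ mn).im / 2 := by gcongr
        _ ≤ c₀ * (ζ mn).im := by linarith [mul_pos hc₀ hζpos]
    refine (hmain' hζpos (by positivity) hrc).trans (ENNReal.ofReal_le_ofReal ?_)
    have hratio : (r / 2 / (ζ mn).im) ^ a ≤ 1 :=
      Real.rpow_le_one (by positivity) ((div_le_one hζpos).2 (by linarith)) ha0.le
    have hbd := hidxbd (Finset.mem_filter.1 hmn).1
    have hnear : ‖ζ mn - z‖ ≤ 3 * y := by
      have hre : (ζ mn - z).re = r / 2 * mn.1 := by rw [Complex.sub_re, hζre]; ring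
      have him : (ζ mn - z).im = r / 2 * mn.2 := by rw [Complex.sub_im, hζim, hy]; ring
      calc ‖ζ mn - z‖ ≤ |(ζ mn - z).re| + |(ζ mn - z).im| := Complex.norm_le_abs_re_add_abs_im _
        _ = r / 2 * |((mn.1 : ℤ) : ℝ)| + r / 2 * |((mn.2 : ℤ) : ℝ)| := by
            rw [hre, him, abs_mul, abs_mul, abs_of_pos (by positivity : (0 : ℝ) < r / 2)]
        _ ≤ r / 2 * M + r / 2 * M := add_le_add (mul_le_mul_of_nonneg_left hbd.1 (by positivity))
            (mul_le_mul_of_nonneg_left hbd.2 (by positivity))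
        _ = r * M := by ring
        _ ≤ 3 * y := hrM
    have hG := ghat_near_le hκ hκ8.le hz hζpos hnear
    calc max C 0 * (r / 2 / (ζ mn).im) ^ a * rsGhatSlope (1 - (κ : ℝ) / 8) κ ((ζ mn).re / (ζ mn).im)
        ≤ max C 0 * 1 * ((64 : ℝ) ^ ghatExp κ * G₀) :=
          mul_le_mul (mul_le_mul_of_nonneg_left hratio hC0) hG (hGpos _).le
            (mul_nonneg hC0 zero_le_one)
      _ = max C 0 * (64 : ℝ) ^ ghatExp κ * G₀ := by ring
  -- Step 3: sum
  have hcard : (idx'.card : ℝ) ≤ Ngrid := by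
    have h1 : idx'.card ≤ idx.card := Finset.card_filter_le _ _
    have hI : (Finset.Icc (-(M : ℤ)) M).card = 2 * M + 1 := by
      rw [Int.card_Icc]; omega
    have h2 : idx.card = (2 * M + 1) * (2 * M + 1) := by
      rw [hidx, Finset.card_product, hI]
    rw [hNgrid, sq]; exact_mod_cast h1.trans_eq h2
  have hεa : c₁ ^ a ≤ (ε / y) ^ a :=
    Real.rpow_le_rpow hc₁0.le ((le_div_iff₀ hz).2 hsmall.le) ha0.le
  have hS0 : 0 ≤ (64 : ℝ) ^ ghatExp κ := by positivity
  have hεy0 : 0 ≤ (ε / y) ^ a := Real.rpow_nonneg (div_nonneg hε.le hz.le) _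
  have hfinal : (idx'.card : ℝ) * (max C 0 * (64 : ℝ) ^ ghatExp κ * G₀) ≤
      max C 0 * (1 + K) * (ε / y) ^ a * G₀ := by
    have hT0 : 0 ≤ max C 0 * (64 : ℝ) ^ ghatExp κ * G₀ := mul_nonneg (mul_nonneg hC0 hS0) hG₀pos.le
    have h1 : (idx'.card : ℝ) * (max C 0 * (64 : ℝ) ^ ghatExp κ * G₀) ≤
        Ngrid * (max C 0 * (64 : ℝ) ^ ghatExp κ * G₀) := mul_le_mul_of_nonneg_right hcard hT0
    have hcc : c₁ ^ (-a) * c₁ ^ a = 1 := by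
      rw [Real.rpow_neg hc₁0.le, inv_mul_cancel₀ (Real.rpow_pos_of_pos hc₁0 a).ne']
    have h2 : Ngrid * (max C 0 * (64 : ℝ) ^ ghatExp κ * G₀) = max C 0 * K * c₁ ^ a * G₀ := by
      calc Ngrid * (max C 0 * (64 : ℝ) ^ ghatExp κ * G₀)
          = Ngrid * (64 : ℝ) ^ ghatExp κ * (c₁ ^ (-a) * c₁ ^ a) * max C 0 * G₀ := by rw [hcc]; ring
        _ = max C 0 * K * c₁ ^ a * G₀ := by rw [hK]; ring
    have hK' : 0 ≤ max C 0 * K := mul_nonneg hC0 hK0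
    have h3 : max C 0 * K * c₁ ^ a * G₀ ≤ max C 0 * K * (ε / y) ^ a * G₀ :=
      mul_le_mul_of_nonneg_right (mul_le_mul_of_nonneg_left hεa hK') hG₀pos.le
    have h4 : max C 0 * K * (ε / y) ^ a * G₀ ≤ max C 0 * (1 + K) * (ε / y) ^ a * G₀ := by
      have h5 : max C 0 * K ≤ max C 0 * (1 + K) := mul_le_mul_of_nonneg_left (by linarith) hC0
      exact mul_le_mul_of_nonneg_right (mul_le_mul_of_nonneg_right h5 hεy0) hG₀pos.le
    linarith
  calc preWienerMeasure {ω | infDist z (range (sleTrace κ ω)) ≤ ε}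
      ≤ preWienerMeasure (⋃ mn ∈ idx', {ω | infDist (ζ mn) (range (sleTrace κ ω)) ≤ r / 2}) :=
        measure_mono hcover
    _ ≤ ∑ mn ∈ idx', preWienerMeasure {ω | infDist (ζ mn) (range (sleTrace κ ω)) ≤ r / 2} :=
        measure_biUnion_finset_le _ _
    _ ≤ ∑ mn ∈ idx', ENNReal.ofReal (max C 0 * (64 : ℝ) ^ ghatExp κ * G₀) := Finset.sum_le_sum hterm
    _ = ENNReal.ofReal (idx'.card * (max C 0 * (64 : ℝ) ^ ghatExp κ * G₀)) := by
        rw [Finset.sum_const, nsmul_eq_mul, ENNReal.ofReal_mul (Nat.cast_nonneg _), ENNReal.ofReal_natCast]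
    _ ≤ ENNReal.ofReal (max C 0 * (1 + K) * (ε / y) ^ a * G₀) := ENNReal.ofReal_le_ofReal hfinal

end Trace

end Literature.Probability.RandomPlanarGeometry
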